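import Literature.Computability.Cryptography.QuantumTuringMachineQSMRun
import Literature.Computability.Complexity.SymbolPrograms
import Literature.Computability.Complexity.StackLists
import HarnessLib

/-!
# The circuit executor on the quantum stack machine, I: the token interpreter

Sequel of `Cryptography/QuantumTuringMachineQSMRun.lean`. A program of the quantum stack machine
(`QTM.QSM.Prog`) is fixed that EXECUTES quantum circuits over a finite unitary gate set `G`
(Nishimura–Ozawa 2002, Lemma 5.1: a quantum Turing machine carrying out a uniform family of
circuits exactly; Bernstein–Vazirani 1997, §4 for the reversible classical control): its code is

* the virtual `goto 1` and `pop U` (the input register holds `1ⁿ⁺¹`, the classical phase wants `1ⁿ`);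
* an arbitrary flat binary stack program `Pf` (`Complexity.AProg Bool (Fin K)`, the normal form of
  polynomial-time Turing machines, `TM2Flat.exists_aprogFin_of_outputsWithin`), run on `1ⁿ`, which
  leaves in its output register the code `code toks = encList (toks.map TokE)` of a list of TOKENS
  `Tok G` — `qpush` (a fresh `|0⟩` at the back of the queue), `rot` (front qubit to the back),
  `swap` (the two front qubits), `gate g` (the gate `g` on the front `arity g` qubits) — each
  written in unary (`TokE`) inside the self-delimiting list format `encList` of the tree;
* the INTERPRETER: a chain of `pop`s decoding the next token and one queue instruction executing
  it (`swap` is the extra gate `none` of the gate set `withSwap G`), looping until the register is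
  empty, then `qread` (the front qubit — wire `0` — goes into the control) and halt.

Main results (all proved; no named fact):

* runs of the abstract machine from superpositions (`bind`, `stepRun`, linearity `stepRun_sum`;
  deterministic sweeps `cstep`, `stepRun_single_of_notGate`; queue superpositions over a control
  state `liftQ`, `stepRun_liftQ_classical`; growth bounds `growth_of_mem_support_stepConf`);
* the instruction table of `execProg` and the semantics of its phases: `cstep_flat` /
  `iterate_cstep_flat` (one sweep per step of `Pf`), `iterate_cstep_decode` (decoding a token),
  **`stepRun_token`** (one token: `cost t` sweeps, the queue superposition transformed by
  `tokOp t` — `qpush`/`rot`/`swap` relabel, `gate g` superposes by the gate matrix on the front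
  qubits), `stepRun_tokens`, `stepRun_readout`, `stepRun_idle`;
* **`acceptWeight_confRun`**: from `tf + tokCost toks + 4` sweeps on, the accepting weight of the
  abstract run is the Born weight of `head = 1` in the token run `tokRun toks` of `|x 0⟩`;
  `stepOK_confRun`: every configuration of the run satisfies the hypotheses `StepOK` of the
  simulation theorem of `QuantumTuringMachineQSMRun.lean`; hence
  **`pacceptProbAt_execProg`** / **`acceptProbAt_execProg`**: the acceptance probability of
  `(execProg D).machine` at the sweep times, in both the positioned and the quotient semantics,
  is that Born weight.

The sequel relates `tokRun` of the routing token list of a circuit to the circuit's acceptance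
probability and supplies the flat program from a uniform family (Nishimura–Ozawa's Lemma 5.1).

## References

* H. Nishimura, M. Ozawa, Theoret. Comput. Sci. 276 (2002) 147–181 [NishimuraOzawa2002]: Lemma 5.1.
* E. Bernstein, U. Vazirani, SIAM J. Comput. 26 (1997) 1411–1473 [BernsteinVaziraniSICOMP1997]: §4.
-/

noncomputable section

namespace Literature.Computability.QuantumComplexity

namespace QSMExec

open Cryptography Complexity QTM QSM QTM.QSM.Prog
open scoped BigOperators

variable (G : QGateSet)

/-! ### The gate set with the swap -/

/-- The SWAP of two qubits: `|x₀ x₁⟩ ↦ |x₁ x₀⟩`. [cite: NishimuraOzawa2002, Lemma 5.1] -/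
def swapGate : Matrix (QReg 2) (QReg 2) ℂ := Matrix.of fun x y => if x 0 = y 1 ∧ x 1 = y 0 then 1 else 0

/-- The swapped register. [folklore] -/
def swapReg (y : QReg 2) : QReg 2 := ![y 1, y 0]

/-- `swapReg` is an involution. [folklore] -/
theorem swapReg_swapReg (y : QReg 2) : swapReg (swapReg y) = y := by
  funext i; fin_cases i <;> rfl

/-- Entries of the swap gate. [folklore] -/
theorem swapGate_apply (x y : QReg 2) : swapGate x y = if x = swapReg y then 1 else 0 := by
  simp only [swapGate, Matrix.of_apply, swapReg]
  congr 1
  apply propext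
  constructor
  · rintro ⟨h0, h1⟩; funext i; fin_cases i <;> simp [h0, h1]
  · intro h; rw [h]; simp

/-- Rows of the swap gate: `swapGate x = δ_{swapReg x}`. [folklore] -/
theorem swapGate_apply' (x y : QReg 2) : swapGate x y = if y = swapReg x then 1 else 0 := by
  rw [swapGate_apply]
  by_cases h : y = swapReg x
  · rw [if_pos h, if_pos (by rw [h, swapReg_swapReg])]
  · rw [if_neg h, if_neg (fun h' => h (by rw [h', swapReg_swapReg]))]

/-- The swap gate is symmetric. [folklore] -/
theorem swapGate_symm_apply (x y : QReg 2) : swapGate x y = swapGate y x := by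
  rw [swapGate_apply, swapGate_apply']

/-- The swap gate is self-adjoint. [folklore] -/
theorem star_swapGate : star swapGate = swapGate := by
  ext x y
  rw [Matrix.star_apply, swapGate_symm_apply y x, swapGate_apply]
  split_ifs <;> simp

/-- The swap gate is an involution. [folklore] -/
theorem swapGate_mul_self : swapGate * swapGate = 1 := by
  ext x y
  rw [Matrix.mul_apply, Matrix.one_apply]
  simp only [swapGate_apply, mul_boole]
  simp only [Finset.sum_ite_eq', Finset.mem_univ, if_true]
  by_cases h : x = y
  · rw [if_pos h, if_pos (by rw [h, swapReg_swapReg])]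
  · rw [if_neg h, if_neg (fun h' => h (by rw [h', swapReg_swapReg]))]

/-- The swap gate is unitary. [folklore] -/
theorem swapGate_mem_unitaryGroup : swapGate ∈ Matrix.unitaryGroup (QReg 2) ℂ := by
  rw [Matrix.mem_unitaryGroup_iff, star_swapGate, swapGate_mul_self]

/-- **The gate set `G` with the swap** (symbol `none`). [cite: NishimuraOzawa2002, Lemma 5.1] -/
abbrev withSwap : QGateSet where
  Op := Option G.Op
  arity o := o.elim 2 G.arity
  mat o := match o with
    | none => swapGate
    | some g => G.mat g

/-- It is unitary if `G` is. [folklore] -/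
theorem withSwap_isUnitary (hG : G.IsUnitary) : (withSwap G).IsUnitary := by
  rintro (_ | g)
  · exact swapGate_mem_unitaryGroup
  · exact hG g

/-- Its symbols are finite. [folklore] -/
instance [Fintype G.Op] : Fintype (withSwap G).Op := inferInstanceAs (Fintype (Option G.Op))

/-- Its symbols have decidable equality. [folklore] -/
instance [DecidableEq G.Op] : DecidableEq (withSwap G).Op := inferInstanceAs (DecidableEq (Option G.Op))

/-! ### Tokens and their code -/

/-- **Tokens**: the elementary queue operations the interpreter executes. [cite: NishimuraOzawa2002, Lemma 5.1] -/
inductive Tok where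
  | qpush : Tok
  | rot : Tok
  | swap : Tok
  | gate (g : G.Op) : Tok

variable {G} [Fintype G.Op]

/-- The index of a token (its unary code length). [folklore] -/
def Tok.idx : Tok G → ℕ
  | Tok.qpush => 0
  | Tok.rot => 1
  | Tok.swap => 2
  | Tok.gate g => 3 + Fintype.equivFin G.Op g

variable (G) in
/-- The largest token index. [folklore] -/
def cmax : ℕ := Fintype.card G.Op + 2

/-- Token indices are at most `cmax`. [folklore] -/
theorem Tok.idx_le (t : Tok G) : t.idx ≤ cmax G := by
  cases t with
  | gate g => have := (Fintype.equivFin G.Op g).isLt; simp [Tok.idx, cmax]; omega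
  | _ => simp [Tok.idx, cmax]

/-- The token of an index. [folklore] -/
def tokOf (c : ℕ) : Option (Tok G) :=
  if c = 0 then some Tok.qpush else if c = 1 then some Tok.rot else if c = 2 then some Tok.swap else
    if h : c - 3 < Fintype.card G.Op then some (Tok.gate ((Fintype.equivFin G.Op).symm ⟨c - 3, h⟩)) else none

/-- `tokOf` inverts `idx`. [folklore] -/
theorem tokOf_idx (t : Tok G) : tokOf t.idx = some t := by
  cases t with
  | qpush => rfl
  | rot => rfl
  | swap => rfl
  | gate g =>
    have := (Fintype.equivFin G.Op g).isLt
    simp only [tokOf, Tok.idx]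
    rw [if_neg (by omega), if_neg (by omega), if_neg (by omega), dif_pos (by simp)]
    simp

/-- The unary code of a token. [folklore] -/
def TokE (t : Tok G) : List Bool := List.replicate t.idx true

/-- **The code of a token list** in the output register of the classical phase: the tree's
self-delimiting list format (`encList`: every bit doubled, separator `01`). [cite: AroraBarak2009, §0.1] -/
def code (toks : List (Tok G)) : List Bool := encList (toks.map TokE)

/-- The code of a non-empty token list. [folklore] -/
theorem code_cons (t : Tok G) (toks : List (Tok G)) :
    code (t :: toks) = List.replicate (2 * t.idx) true ++ false :: true :: code toks := by
  rw [code, List.map_cons, encList_cons, boolPair, TokE]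
  simp only [code, List.append_assoc, List.cons_append, List.nil_append]
  congr 1
  induction t.idx with
  | zero => rfl
  | succ k ih => rw [List.replicate_succ, List.flatMap_cons, ih]; simp [Nat.mul_succ, List.replicate_succ]

/-! ### The action of tokens on queue superpositions -/

/-- Swapping the two front entries of a list. [folklore] -/
def swapFront : List Bool → List Bool
  | a :: b :: r => b :: a :: r
  | l => l

/-- **The action of a gate on the front qubits of a queue superposition.** [cite: NishimuraOzawa2002, Lemma 5.1] -/
def gateOp (g : G.Op) (Φ : List Bool →₀ ℂ) : List Bool →₀ ℂ :=
  Φ.sum fun q a => if h : G.arity g ≤ q.length then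
    ∑ z : QReg (G.arity g), Finsupp.single (List.ofFn z ++ q.drop (G.arity g)) (a * G.mat g z (vecOf (q.take (G.arity g)) (by simp; omega)))
    else 0

/-- **The action of a token on a queue superposition.** [cite: NishimuraOzawa2002, Lemma 5.1] -/
def tokOp : Tok G → (List Bool →₀ ℂ) → (List Bool →₀ ℂ)
  | Tok.qpush, Φ => Φ.mapDomain fun q => q ++ [false]
  | Tok.rot, Φ => Φ.mapDomain fun q => q.tail ++ q.take 1
  | Tok.swap, Φ => Φ.mapDomain swapFront
  | Tok.gate g, Φ => gateOp g Φ

/-- The action of a token list. [folklore] -/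
def tokRun : List (Tok G) → (List Bool →₀ ℂ) → (List Bool →₀ ℂ)
  | [], Φ => Φ
  | t :: toks, Φ => tokRun toks (tokOp t Φ)

/-- The number of sweeps spent on a token. [folklore] -/
def Tok.cost (t : Tok G) : ℕ := 2 * t.idx + 3

/-- The growth of the dead prefix on a token. [folklore] -/
def Tok.deadInc : Tok G → ℕ
  | Tok.rot => 1
  | _ => 0

/-- The growth of the queue on a token. [folklore] -/
def Tok.pushInc : Tok G → ℕ
  | Tok.qpush => 1
  | _ => 0

/-- **The shape condition of a token** on queues of length `N`. [folklore] -/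
def Tok.OK : Tok G → ℕ → Prop
  | Tok.qpush, _ => True
  | Tok.rot, N => 1 ≤ N
  | Tok.swap, N => 2 ≤ N
  | Tok.gate g, N => G.arity g ≤ N ∧ 1 ≤ N

omit [Fintype G.Op] in
/-- Tokens preserve "all queues have length `N`" (with the push increment). [folklore] -/
theorem length_of_mem_support_tokOp (t : Tok G) {Φ : List Bool →₀ ℂ} {N : ℕ} (hN : ∀ q ∈ Φ.support, q.length = N)
    (hok : t.OK N) : ∀ q ∈ (tokOp t Φ).support, q.length = N + t.pushInc := by
  classical
  intro q hq
  rcases t with _ | _ | _ | g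
  · obtain ⟨q₀, hq₀, rfl⟩ := Finset.mem_image.1 (Finsupp.mapDomain_support hq)
    simp [hN q₀ hq₀, Tok.pushInc]
  · obtain ⟨q₀, hq₀, rfl⟩ := Finset.mem_image.1 (Finsupp.mapDomain_support hq)
    have := hN q₀ hq₀
    simp only [Tok.OK] at hok
    simp [Tok.pushInc]; omega
  · obtain ⟨q₀, hq₀, rfl⟩ := Finset.mem_image.1 (Finsupp.mapDomain_support hq)
    have := hN q₀ hq₀
    rcases q₀ with _ | ⟨a, _ | ⟨b, r⟩⟩ <;> simp [swapFront, Tok.pushInc] at this ⊢ <;> omega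
  · -- gate: every branch has the length of its source queue
    simp only [tokOp, gateOp] at hq
    obtain ⟨q₀, hq₀, hq'⟩ := Finset.mem_biUnion.1 (Finsupp.support_sum hq)
    have hlen := hN q₀ hq₀
    split_ifs at hq' with h
    · obtain ⟨z, -, hz⟩ := Finset.mem_biUnion.1 (Finsupp.support_finsetSum hq')
      have := Finsupp.support_single_subset hz
      simp only [Finset.mem_singleton] at this
      subst this
      simp [hlen, Tok.pushInc]; omega
    · simp at hq'

/-! ### The executor program -/

variable (G) in
/-- The parking bound: `2` for the swap and the largest arity. [folklore] -/
def amax : ℕ := max 2 (Finset.univ.sup G.arity)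

/-- Arities are within the parking bound. [folklore] -/
theorem arity_le_amax (o : (withSwap G).Op) : (withSwap G).arity o ≤ amax G := by
  rcases o with _ | g
  · exact le_max_left _ _
  · exact (Finset.le_sup (f := G.arity) (Finset.mem_univ g)).trans (le_max_right _ _)

/-- **The data of an executor** over the gate set `G`: a flat binary stack program with its input
and output registers. [folklore] -/
@[nolint unusedArguments]
structure ExecData (G : QGateSet) where
  /-- the number of registers -/
  K : ℕ
  /-- the flat program of the classical phase -/
  Pf : AProg Bool (Fin K)
  /-- its input register (holding `1ⁿ`) -/
  inp : Fin K
  /-- its output register (receiving the token code) -/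
  out : Fin K

/-! ### Runs of the abstract machine from a superposition -/

section Runs

open scoped Classical

variable (P : Prog)

/-- One sweep of the abstract machine on a superposition of configurations. [folklore] -/
def bind (v : P.Conf →₀ ℂ) : P.Conf →₀ ℂ :=
  v.sum fun c a => (P.stepConf c).sum fun c' m => Finsupp.single c' (a * m)

/-- `t` sweeps of the abstract machine. [folklore] -/
def stepRun : ℕ → (P.Conf →₀ ℂ) → (P.Conf →₀ ℂ)
  | 0, v => v
  | t + 1, v => bind P (stepRun t v)

/-- The abstract run is the iterated sweep from the first configuration. [folklore] -/
theorem confRun_eq_stepRun (x : List Bool) (s : ℕ) : P.confRun x s = stepRun P s (Finsupp.single (P.conf₁ x) 1) := by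
  induction s with
  | zero => rfl
  | succ s ih => rw [confRun, ih]; rfl

/-- `bind` is additive. [folklore] -/
theorem bind_add (v w : P.Conf →₀ ℂ) : bind P (v + w) = bind P v + bind P w := by
  unfold bind
  rw [Finsupp.sum_add_index (by simp) (by intros; simp [add_mul, Finsupp.sum_add])]

/-- `bind` of zero. [folklore] -/
@[simp] theorem bind_zero : bind P 0 = 0 := by simp [bind]

/-- `bind` of a single configuration. [folklore] -/
theorem bind_single (c : P.Conf) (a : ℂ) : bind P (Finsupp.single c a) = (P.stepConf c).sum fun c' m => Finsupp.single c' (a * m) := by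
  rw [bind, Finsupp.sum_single_index (by simp)]

/-- `bind` is homogeneous. [folklore] -/
theorem bind_smul (a : ℂ) (v : P.Conf →₀ ℂ) : bind P (a • v) = a • bind P v := by
  unfold bind
  rw [Finsupp.sum_smul_index (by simp), Finsupp.smul_sum]
  refine Finsupp.sum_congr fun c _ => ?_
  rw [Finsupp.smul_sum]
  refine Finsupp.sum_congr fun c' _ => ?_
  rw [Finsupp.smul_single, smul_eq_mul, mul_assoc]

/-- `stepRun` is additive. [folklore] -/
theorem stepRun_add (t : ℕ) (v w : P.Conf →₀ ℂ) : stepRun P t (v + w) = stepRun P t v + stepRun P t w := by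
  induction t with
  | zero => rfl
  | succ t ih => simp [stepRun, ih, bind_add]

/-- `stepRun` of zero. [folklore] -/
@[simp] theorem stepRun_zero' (t : ℕ) : stepRun P t 0 = 0 := by
  induction t with
  | zero => rfl
  | succ t ih => simp [stepRun, ih]

/-- `stepRun` is homogeneous. [folklore] -/
theorem stepRun_smul (t : ℕ) (a : ℂ) (v : P.Conf →₀ ℂ) : stepRun P t (a • v) = a • stepRun P t v := by
  induction t with
  | zero => rfl
  | succ t ih => simp [stepRun, ih, bind_smul]

/-- **Linearity**: the run of a superposition is the superposition of the runs. [folklore] -/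
theorem stepRun_sum (t : ℕ) (v : P.Conf →₀ ℂ) :
    stepRun P t v = v.sum fun c a => a • stepRun P t (Finsupp.single c 1) := by
  conv_lhs => rw [← Finsupp.sum_single v]
  rw [Finsupp.sum, Finsupp.sum]
  have := map_sum (⟨⟨stepRun P t, stepRun_zero' P t⟩, stepRun_add P t⟩ : (P.Conf →₀ ℂ) →+ (P.Conf →₀ ℂ))
    (fun a => Finsupp.single a (v a)) v.support
  simp only [AddMonoidHom.coe_mk, ZeroHom.coe_mk] at this
  rw [this]
  refine Finset.sum_congr rfl fun c _ => ?_
  rw [← stepRun_smul, Finsupp.smul_single, smul_eq_mul, mul_one]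

/-- Runs compose. [folklore] -/
theorem stepRun_add_steps (t₁ t₂ : ℕ) (v : P.Conf →₀ ℂ) : stepRun P (t₁ + t₂) v = stepRun P t₂ (stepRun P t₁ v) := by
  induction t₂ with
  | zero => rfl
  | succ t₂ ih => rw [Nat.add_succ, stepRun, ih]; rfl

/-! ### Deterministic sweeps -/

/-- The pending address of a boundary configuration: the instruction its sweep executes. [folklore] -/
def pend (c : P.Conf) : P.PC := P.next (c.cur, c.res)

/-- **The deterministic successor** of a boundary configuration (meaningful when the pending
instruction is not a gate). [folklore] -/
def cstep (c : P.Conf) : P.Conf :=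
  let c₁ := P.commit c
  match P.instr c₁.cur with
  | none => { c₁ with res := PopRes.notpop }
  | some (QInstr.push k b) => { c₁ with res := PopRes.notpop, regs := Function.update c₁.regs k (b :: c₁.regs k) }
  | some (QInstr.pop k _) =>
      { c₁ with res := PopRes.popped (c₁.regs k).head?, regs := Function.update c₁.regs k (c₁.regs k).tail }
  | some (QInstr.goto _) => { c₁ with res := PopRes.notpop }
  | some (QInstr.qpush b _) => { c₁ with res := PopRes.notpop, queue := c₁.queue ++ [b] }
  | some (QInstr.qrot _) => { c₁ with res := PopRes.notpop, queue := c₁.queue.tail ++ c₁.queue.take 1, dead := c₁.dead + 1 }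
  | some (QInstr.qgate _ _) => c₁
  | some (QInstr.qread _) =>
      { c₁ with res := PopRes.notpop, queue := c₁.queue.tail, dead := c₁.dead + 1, parked := c₁.queue.take 1 }

/-- A pending instruction that is not a gate. [folklore] -/
def NotGate (c : P.Conf) : Prop := ∀ g j, P.instr (pend P c) ≠ some (QInstr.qgate g j)

/-- **Off gates the abstract step is deterministic.** [folklore] -/
theorem stepConf_of_notGate {c : P.Conf} (h : NotGate P c) : P.stepConf c = Finsupp.single (cstep P c) 1 := by
  unfold stepConf cstep
  have hc : (P.commit c).cur = pend P c := rfl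
  simp only [hc]
  rcases hi : P.instr (pend P c) with _ | ⟨k, b⟩ | ⟨k, j⟩ | j | ⟨b, j⟩ | j | ⟨g, j⟩ | j <;> simp only
  exact absurd hi (h g j)

/-- `bind` of a deterministic configuration. [folklore] -/
theorem bind_single_of_notGate {c : P.Conf} (h : NotGate P c) (a : ℂ) :
    bind P (Finsupp.single c a) = Finsupp.single (cstep P c) a := by
  rw [bind_single, stepConf_of_notGate P h, Finsupp.sum_single_index (by simp), mul_one]

/-- **A deterministic stretch**: `t` sweeps off gates. [folklore] -/
theorem stepRun_single_of_notGate (t : ℕ) (c : P.Conf) (h : ∀ i < t, NotGate P ((cstep P)^[i] c)) (a : ℂ) :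
    stepRun P t (Finsupp.single c a) = Finsupp.single ((cstep P)^[t] c) a := by
  induction t with
  | zero => rfl
  | succ t ih =>
    rw [stepRun, ih (fun i hi => h i (by omega)), bind_single_of_notGate P (h t (by omega)),
      Function.iterate_succ_apply']

/-! ### The deterministic successor, by instruction -/

/-- The pending address after a deterministic sweep is `next` of the executed instruction's record. [folklore] -/
theorem pend_cstep_eq (c : P.Conf) : pend P (cstep P c) = P.next (pend P c, (cstep P c).res) := by
  unfold cstep
  have hc : (P.commit c).cur = pend P c := rfl
  simp only [hc]
  rcases P.instr (pend P c) with _ | ⟨k, b⟩ | ⟨k, j⟩ | j | ⟨b, j⟩ | j | ⟨g, j⟩ | j <;> rfl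

/-- Sweep of a `pop k j`. [folklore] -/
theorem cstep_of_pop {c : P.Conf} {k : Fin P.K} {j : Option Bool → ℕ} (hi : P.instr (pend P c) = some (QInstr.pop k j)) :
    cstep P c = { P.commit c with res := PopRes.popped (c.regs k).head?, regs := Function.update c.regs k (c.regs k).tail } ∧
      pend P (cstep P c) = P.clamp (j (c.regs k).head?) := by
  have h1 : cstep P c = { P.commit c with res := PopRes.popped (c.regs k).head?, regs := Function.update c.regs k (c.regs k).tail } := by
    unfold cstep
    have hc : (P.commit c).cur = pend P c := rfl
    simp only [hc, hi]
    rfl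
  refine ⟨h1, ?_⟩
  rw [pend_cstep_eq P c, h1]
  show P.next (pend P c, PopRes.popped (c.regs k).head?) = _
  unfold Prog.next
  rw [hi]

/-- Sweep of a `goto j`. [folklore] -/
theorem cstep_of_goto {c : P.Conf} {j : ℕ} (hi : P.instr (pend P c) = some (QInstr.goto j)) :
    cstep P c = { P.commit c with res := PopRes.notpop } ∧ pend P (cstep P c) = P.clamp j := by
  have h1 : cstep P c = { P.commit c with res := PopRes.notpop } := by
    unfold cstep
    have hc : (P.commit c).cur = pend P c := rfl
    simp only [hc, hi]
  refine ⟨h1, ?_⟩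
  rw [pend_cstep_eq P c, h1]
  show P.next (pend P c, PopRes.notpop) = _
  unfold Prog.next
  rw [hi]

/-- Sweep of a `qpush b j`. [folklore] -/
theorem cstep_of_qpush {c : P.Conf} {b : Bool} {j : ℕ} (hi : P.instr (pend P c) = some (QInstr.qpush b j)) :
    cstep P c = { P.commit c with res := PopRes.notpop, queue := c.queue ++ [b] } ∧ pend P (cstep P c) = P.clamp j := by
  have h1 : cstep P c = { P.commit c with res := PopRes.notpop, queue := c.queue ++ [b] } := by
    unfold cstep
    have hc : (P.commit c).cur = pend P c := rfl
    simp only [hc, hi]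
    rfl
  refine ⟨h1, ?_⟩
  rw [pend_cstep_eq P c, h1]
  show P.next (pend P c, PopRes.notpop) = _
  unfold Prog.next
  rw [hi]

/-- Sweep of a `qrot j`. [folklore] -/
theorem cstep_of_qrot {c : P.Conf} {j : ℕ} (hi : P.instr (pend P c) = some (QInstr.qrot j)) :
    cstep P c = { P.commit c with res := PopRes.notpop, queue := c.queue.tail ++ c.queue.take 1, dead := c.dead + 1 } ∧
      pend P (cstep P c) = P.clamp j := by
  have h1 : cstep P c = { P.commit c with res := PopRes.notpop, queue := c.queue.tail ++ c.queue.take 1, dead := c.dead + 1 } := by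
    unfold cstep
    have hc : (P.commit c).cur = pend P c := rfl
    simp only [hc, hi]
    rfl
  refine ⟨h1, ?_⟩
  rw [pend_cstep_eq P c, h1]
  show P.next (pend P c, PopRes.notpop) = _
  unfold Prog.next
  rw [hi]

/-- Sweep of a `qread j`. [folklore] -/
theorem cstep_of_qread {c : P.Conf} {j : ℕ} (hi : P.instr (pend P c) = some (QInstr.qread j)) :
    cstep P c = { P.commit c with res := PopRes.notpop, queue := c.queue.tail, dead := c.dead + 1, parked := c.queue.take 1 } ∧
      pend P (cstep P c) = P.clamp j := by
  have h1 : cstep P c = { P.commit c with res := PopRes.notpop, queue := c.queue.tail, dead := c.dead + 1, parked := c.queue.take 1 } := by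
    unfold cstep
    have hc : (P.commit c).cur = pend P c := rfl
    simp only [hc, hi]
    rfl
  refine ⟨h1, ?_⟩
  rw [pend_cstep_eq P c, h1]
  show P.next (pend P c, PopRes.notpop) = _
  unfold Prog.next
  rw [hi]

/-- Sweep at the halting address. [folklore] -/
theorem cstep_of_none {c : P.Conf} (hi : P.instr (pend P c) = none) :
    cstep P c = { P.commit c with res := PopRes.notpop } ∧ pend P (cstep P c) = pend P c := by
  have h1 : cstep P c = { P.commit c with res := PopRes.notpop } := by
    unfold cstep
    have hc : (P.commit c).cur = pend P c := rfl
    simp only [hc, hi]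
  refine ⟨h1, ?_⟩
  rw [pend_cstep_eq P c, h1]
  show P.next (pend P c, PopRes.notpop) = _
  unfold Prog.next
  rw [hi]

/-- Every sweep records one history entry. [folklore] -/
theorem length_hist_cstep (c : P.Conf) : (cstep P c).hist.length = c.hist.length + 1 := by
  rcases h : P.instr (P.next (c.cur, c.res)) with _ | ⟨k, b⟩ | ⟨k, j⟩ | j | ⟨b, j⟩ | j | ⟨g, j⟩ | j <;>
    simp [cstep, commit, h]

/-- `t` sweeps record `t` history entries. [folklore] -/
theorem length_hist_iterate_cstep (t : ℕ) (c : P.Conf) : ((cstep P)^[t] c).hist.length = c.hist.length + t := by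
  induction t generalizing c with
  | zero => rfl
  | succ t ih => rw [Function.iterate_succ_apply, ih, length_hist_cstep]; omega

/-- A pending instruction that does not touch the queue. [folklore] -/
def Classical' (c : P.Conf) : Prop :=
  P.instr (pend P c) = none ∨ (∃ k b, P.instr (pend P c) = some (QInstr.push k b)) ∨
    (∃ k j, P.instr (pend P c) = some (QInstr.pop k j)) ∨ ∃ j, P.instr (pend P c) = some (QInstr.goto j)

/-- **Classical sweeps commute with replacing the queue.** [folklore] -/
theorem cstep_queue (c : P.Conf) (h : Classical' P c) (q : List Bool) :
    cstep P { c with queue := q } = { cstep P c with queue := q } := by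
  have hp : pend P { c with queue := q } = pend P c := rfl
  unfold cstep
  have hc : (P.commit c).cur = pend P c := rfl
  have hc' : (P.commit { c with queue := q }).cur = pend P c := rfl
  simp only [hc, hc']
  rcases h with h | ⟨k, b, h⟩ | ⟨k, j, h⟩ | ⟨j, h⟩ <;> simp only [h] <;> rfl

/-- Classical sweeps are not gates. [folklore] -/
theorem notGate_of_classical {c : P.Conf} (h : Classical' P c) : NotGate P c := by
  intro g j hg
  rcases h with h | ⟨k, b, h⟩ | ⟨k, j, h⟩ | ⟨j, h⟩ <;> rw [h] at hg <;> cases hg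

/-- Iterated classical sweeps commute with replacing the queue. [folklore] -/
theorem iterate_cstep_queue (t : ℕ) : ∀ (c : P.Conf), (∀ i < t, Classical' P ((cstep P)^[i] c)) → ∀ q : List Bool,
    (cstep P)^[t] { c with queue := q } = { (cstep P)^[t] c with queue := q } := by
  induction t with
  | zero => intro c _ q; rfl
  | succ t ih =>
    intro c h q
    rw [Function.iterate_succ_apply, Function.iterate_succ_apply, cstep_queue P c (h 0 (Nat.zero_lt_succ _)) q]
    exact ih (cstep P c) (fun i hi => by have := h (i + 1) (by omega); rwa [Function.iterate_succ_apply] at this) q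

/-! ### Growth bounds of one sweep -/

/-- **One sweep grows every structure by at most one cell** (and records one history entry; the
parked register has at most `max |parked| 1` qubits). [folklore] -/
theorem growth_of_mem_support_stepConf {c c' : P.Conf} (h : c' ∈ (P.stepConf c).support) :
    c'.hist.length = c.hist.length + 1 ∧ c'.parked.length ≤ max c.parked.length 1 ∧
      (∀ k, (c'.regs k).length ≤ (c.regs k).length + 1) ∧ c'.dead + c'.queue.length ≤ c.dead + c.queue.length + 1 := by
  classical
  have hsingle : ∀ {c'' : P.Conf}, c' ∈ (Finsupp.single c'' (1 : ℂ)).support → c' = c'' := fun h => by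
    simpa using Finsupp.support_single_subset h
  rcases hi : P.instr (P.commit c).cur with _ | ⟨k, b⟩ | ⟨k, j⟩ | j | ⟨b, j⟩ | j | ⟨g, j⟩ | j <;>
    simp only [stepConf, hi] at h
  · obtain rfl := hsingle h; simp [commit]
  · obtain rfl := hsingle h
    refine ⟨by simp [commit], by simp [commit], fun k' => ?_, by simp [commit]⟩
    by_cases hk : k' = k
    · subst hk; simp [commit]
    · simp [commit, hk]
  · obtain rfl := hsingle h
    refine ⟨by simp [commit], by simp [commit], fun k' => ?_, by simp [commit]⟩
    by_cases hk : k' = k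
    · subst hk; simp [commit]; omega
    · simp [commit, hk]
  · obtain rfl := hsingle h; simp [commit]
  · obtain rfl := hsingle h; simp [commit]; omega
  · obtain rfl := hsingle h
    refine ⟨by simp [commit], by simp [commit], fun k => by simp [commit], ?_⟩
    simp only [commit]
    cases c.queue <;> simp; omega
  · split_ifs at h with hk
    · obtain ⟨z, -, hz⟩ := Finset.mem_biUnion.1 (Finsupp.support_finsetSum h)
      have := Finsupp.support_single_subset hz
      simp only [Finset.mem_singleton] at this
      subst this
      refine ⟨by simp [commit], by simp [commit], fun k => by simp [commit], ?_⟩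
      simp only [commit] at hk ⊢
      simp; omega
    · simp at h
  · obtain rfl := hsingle h
    refine ⟨by simp [commit], by simp [commit], fun k => by simp [commit], ?_⟩
    simp only [commit]
    cases c.queue <;> simp; omega

/-- Supports of `bind`. [folklore] -/
theorem mem_support_bind {v : P.Conf →₀ ℂ} {c' : P.Conf} (h : c' ∈ (bind P v).support) :
    ∃ c ∈ v.support, c' ∈ (P.stepConf c).support := by
  classical
  unfold bind at h
  obtain ⟨c, hc, h'⟩ := Finset.mem_biUnion.1 (Finsupp.support_sum h)
  obtain ⟨c'', hc'', h''⟩ := Finset.mem_biUnion.1 (Finsupp.support_sum h')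
  have := Finsupp.support_single_subset h''
  simp only [Finset.mem_singleton] at this
  subst this
  exact ⟨c, hc, hc''⟩

/-! ### Queue superpositions over a classical control state -/

/-- **The lift of a queue superposition** `Φ` over the control/register part of `κ`. [folklore] -/
def liftQ (κ : P.Conf) (Φ : List Bool →₀ ℂ) : P.Conf →₀ ℂ := Φ.sum fun q a => Finsupp.single { κ with queue := q } a

/-- `liftQ` of a `mapDomain`. [folklore] -/
theorem liftQ_mapDomain (κ : P.Conf) (f : List Bool → List Bool) (Φ : List Bool →₀ ℂ) :
    liftQ P κ (Φ.mapDomain f) = Φ.sum fun q a => Finsupp.single { κ with queue := f q } a := by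
  rw [liftQ, Finsupp.mapDomain, Finsupp.sum_sum_index (by simp) (by intros; simp)]
  refine Finsupp.sum_congr fun q _ => ?_
  rw [Finsupp.sum_single_index (by simp)]

/-- `liftQ` of a `Finsupp.sum`. [folklore] -/
theorem liftQ_sum {α : Type} (κ : P.Conf) (v : α →₀ ℂ) (F : α → ℂ → (List Bool →₀ ℂ)) :
    liftQ P κ (v.sum F) = v.sum fun x a => liftQ P κ (F x a) := by
  unfold liftQ
  rw [Finsupp.sum_sum_index (by simp) (by intros; simp)]

/-- `liftQ` of a single queue. [folklore] -/
@[simp] theorem liftQ_single (κ : P.Conf) (q : List Bool) (a : ℂ) : liftQ P κ (Finsupp.single q a) = Finsupp.single { κ with queue := q } a := by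
  rw [liftQ, Finsupp.sum_single_index (by simp)]

/-- `liftQ` is additive. [folklore] -/
theorem liftQ_add (κ : P.Conf) (Φ Ψ : List Bool →₀ ℂ) : liftQ P κ (Φ + Ψ) = liftQ P κ Φ + liftQ P κ Ψ := by
  unfold liftQ; rw [Finsupp.sum_add_index (by simp) (by intros; simp)]

/-- `liftQ` of zero. [folklore] -/
@[simp] theorem liftQ_zero (κ : P.Conf) : liftQ P κ 0 = 0 := by simp [liftQ]

/-- `liftQ` of a finite sum. [folklore] -/
theorem liftQ_finset_sum {ι : Type} (κ : P.Conf) (S : Finset ι) (f : ι → (List Bool →₀ ℂ)) :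
    liftQ P κ (∑ i ∈ S, f i) = ∑ i ∈ S, liftQ P κ (f i) :=
  map_sum (⟨⟨liftQ P κ, liftQ_zero P κ⟩, liftQ_add P κ⟩ : (List Bool →₀ ℂ) →+ (P.Conf →₀ ℂ)) f S

/-- `bind` over a lift is branch-wise. [folklore] -/
theorem bind_liftQ (κ : P.Conf) (Φ : List Bool →₀ ℂ) :
    bind P (liftQ P κ Φ) = Φ.sum fun q a => bind P (Finsupp.single { κ with queue := q } a) := by
  rw [liftQ, Finsupp.sum, Finsupp.sum]
  exact map_sum (⟨⟨bind P, bind_zero P⟩, bind_add P⟩ : (P.Conf →₀ ℂ) →+ (P.Conf →₀ ℂ)) _ _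

/-- **A classical stretch on a lift**: the control advances, the superposition is carried along. [folklore] -/
theorem stepRun_liftQ_classical (t : ℕ) (κ : P.Conf) (h : ∀ i < t, Classical' P ((cstep P)^[i] κ)) (Φ : List Bool →₀ ℂ) :
    stepRun P t (liftQ P κ Φ) = liftQ P ((cstep P)^[t] κ) Φ := by
  rw [stepRun_sum, liftQ, Finsupp.sum_sum_index (by simp) (by intros; simp [add_smul])]
  refine Finsupp.sum_congr fun q _ => ?_
  rw [Finsupp.sum_single_index (by simp), stepRun_single_of_notGate P t _ (fun i hi => ?_), ← iterate_cstep_queue P t κ h q,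
    Finsupp.smul_single, smul_eq_mul, mul_one]
  rw [iterate_cstep_queue P i κ (fun j hj => h j (by omega)) q]
  exact notGate_of_classical P (by have := h i hi; exact this)

/-- **The lift with read-out**: the front qubit parked, the rest of the queue on the track. [folklore] -/
def liftQP (κ : P.Conf) (Φ : List Bool →₀ ℂ) : P.Conf →₀ ℂ :=
  Φ.sum fun q a => Finsupp.single { κ with queue := q.tail, parked := q.take 1 } a

/-! ### Shape conditions of the pending queue instruction -/

/-- **The shape conditions** the pending queue instruction of a configuration needs
(cf. `Prog.StepOK`). [folklore] -/
def QShape (c : P.Conf) : Prop :=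
  (∀ j, P.instr (pend P c) = some (QInstr.qrot j) → c.queue ≠ []) ∧
    (∀ g j, P.instr (pend P c) = some (QInstr.qgate g j) → c.parked = [] ∧ c.queue ≠ [] ∧ P.G.arity g ≤ c.queue.length) ∧
    (∀ j, P.instr (pend P c) = some (QInstr.qread j) → c.queue ≠ [] ∧ c.parked = [])

/-- All configurations of a superposition have their shape conditions. [folklore] -/
def GoodV (v : P.Conf →₀ ℂ) : Prop := ∀ c ∈ v.support, QShape P c

/-- Classical configurations have no shape condition. [folklore] -/
theorem qShape_of_classical {c : P.Conf} (h : Classical' P c) : QShape P c := by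
  refine ⟨fun j hj => ?_, fun g j hj => ?_, fun j hj => ?_⟩ <;>
    rcases h with h | ⟨k, b, h⟩ | ⟨k, j', h⟩ | ⟨j', h⟩ <;> rw [h] at hj <;> cases hj

/-- A lift over a classical control state is good. [folklore] -/
theorem goodV_liftQ_of_classical {κ : P.Conf} (h : Classical' P κ) (Φ : List Bool →₀ ℂ) : GoodV P (liftQ P κ Φ) := by
  classical
  intro c hc
  rw [liftQ] at hc
  obtain ⟨q, -, hq⟩ := Finset.mem_biUnion.1 (Finsupp.support_sum hc)
  have := Finsupp.support_single_subset hq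
  simp only [Finset.mem_singleton] at this
  subst this
  exact qShape_of_classical P h

/-- A halted read-out lift is good. [folklore] -/
theorem goodV_liftQP_of_none {κ : P.Conf} (h : P.instr (pend P κ) = none) (Φ : List Bool →₀ ℂ) : GoodV P (liftQP P κ Φ) := by
  classical
  intro c hc
  rw [liftQP] at hc
  obtain ⟨q, -, hq⟩ := Finset.mem_biUnion.1 (Finsupp.support_sum hc)
  have := Finsupp.support_single_subset hq
  simp only [Finset.mem_singleton] at this
  subst this
  exact qShape_of_classical P (Or.inl h)

/-- **Sweep of a gate `qgate g j`**: the superposition of the gate matrix on the front qubits,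
every branch pending at `j`. [cite: NishimuraOzawa2002, Lemma 5.1] -/
theorem stepConf_of_qgate {c : P.Conf} {g : P.G.Op} {j : ℕ} (hi : P.instr (pend P c) = some (QInstr.qgate g j))
    (hk : P.G.arity g ≤ c.queue.length) :
    P.stepConf c = ∑ z : QReg (P.G.arity g),
      Finsupp.single { P.commit c with res := PopRes.notpop, queue := List.ofFn z ++ c.queue.drop (P.G.arity g) }
        (P.G.mat g z (vecOf (c.queue.take (P.G.arity g)) (by simp; omega))) := by
  unfold stepConf
  have hc : (P.commit c).cur = pend P c := rfl
  simp only [hc, hi]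
  rw [dif_pos (show P.G.arity g ≤ (P.commit c).queue.length from hk)]
  rfl

/-- The branches of a gate sweep are pending at its continuation. [folklore] -/
theorem pend_gate_branch {c : P.Conf} {g : P.G.Op} {j : ℕ} (hi : P.instr (pend P c) = some (QInstr.qgate g j)) (q : List Bool) :
    pend P { P.commit c with res := PopRes.notpop, queue := q } = P.clamp j := by
  show P.next (pend P c, PopRes.notpop) = _
  unfold Prog.next
  rw [hi]

end Runs

namespace ExecData

variable (D : ExecData G)

/-- The translation of a flat instruction (addresses shifted by the two leading instructions). [folklore] -/
def trInstr : AInstr Bool (Fin D.K) → QInstr D.K (Option G.Op)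
  | AInstr.push k a => QInstr.push k a
  | AInstr.pop k j => QInstr.pop k fun o => j o + 2
  | AInstr.goto j => QInstr.goto (j + 2)

/-- The base address of the interpreter. [folklore] -/
def base : ℕ := D.Pf.length + 2

/-- Address of the decoding block `A c` (read a bit pair: `none` → read-out, `1…` → count on, `0…` → execute). [folklore] -/
def addrA (c : ℕ) : ℕ := D.base + 4 * c
/-- Address of `B c` (drop the doubled `1`, continue with `A (c+1)`). [folklore] -/
def addrB (c : ℕ) : ℕ := D.base + 4 * c + 1
/-- Address of `D c` (drop the `1` of the separator `01`, continue with `E c`). [folklore] -/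
def addrD (c : ℕ) : ℕ := D.base + 4 * c + 2
/-- Address of `E c` (execute token `c`, continue with `A 0`). [folklore] -/
def addrE (c : ℕ) : ℕ := D.base + 4 * c + 3
/-- Address of the read-out. [folklore] -/
def addrR : ℕ := D.base + 4 * (cmax G + 1)

/-- `base ≤ addrR`. [folklore] -/
theorem base_le_addrR : D.base ≤ D.addrR := by unfold addrR; omega

omit [Fintype G.Op] in
/-- `2 ≤ base`. [folklore] -/
theorem two_le_base : 2 ≤ D.base := by unfold base; omega

/-- `A c ≤ addrR`. [folklore] -/
theorem addrA_le {c : ℕ} (hc : c ≤ cmax G + 1) : D.addrA c ≤ D.addrR := by unfold addrA addrR; nlinarith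
/-- `B c ≤ addrR`. [folklore] -/
theorem addrB_le {c : ℕ} (hc : c ≤ cmax G) : D.addrB c ≤ D.addrR := by unfold addrB addrR; nlinarith
/-- `D c ≤ addrR`. [folklore] -/
theorem addrD_le {c : ℕ} (hc : c ≤ cmax G) : D.addrD c ≤ D.addrR := by unfold addrD addrR; nlinarith
/-- `E c ≤ addrR`. [folklore] -/
theorem addrE_le {c : ℕ} (hc : c ≤ cmax G) : D.addrE c ≤ D.addrR := by unfold addrE addrR; nlinarith

omit [Fintype G.Op] in
/-- **The first passage of the flat program through its end.** If `Pf` runs from `⟨pc₀, R₀⟩` to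
`⟨|Pf|, R'⟩` in `t` steps, then it first reaches address `|Pf|` at some `t₀ ≤ t`, with the same
register file and all earlier addresses `< |Pf|`. [folklore] -/
theorem exists_first_halt {pc₀ : ℕ} {R₀ R' : AStore Bool (Fin D.K)} {t : ℕ}
    (h : D.Pf.step^[t] ⟨pc₀, R₀⟩ = ⟨D.Pf.length, R'⟩) :
    ∃ t₀ ≤ t, D.Pf.step^[t₀] ⟨pc₀, R₀⟩ = ⟨D.Pf.length, R'⟩ ∧ ∀ i < t₀, (D.Pf.step^[i] ⟨pc₀, R₀⟩).pc < D.Pf.length := by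
  classical
  -- the first time the address is `≥ |Pf|`
  have hex : ∃ t₀, D.Pf.length ≤ (D.Pf.step^[t₀] ⟨pc₀, R₀⟩).pc := ⟨t, by rw [h]⟩
  refine ⟨Nat.find hex, Nat.find_min' hex (by rw [h]), ?_, fun i hi => Nat.lt_of_not_le (Nat.find_min hex hi)⟩
  -- from the first passage on, the configuration is fixed; at time `t` it is `⟨|Pf|, R'⟩`
  have hfix : ∀ j, D.Pf.step^[Nat.find hex + j] ⟨pc₀, R₀⟩ = D.Pf.step^[Nat.find hex] ⟨pc₀, R₀⟩ := fun j => by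
    rw [Nat.add_comm, Function.iterate_add_apply]
    exact AProg.iterate_step_of_le _ (Nat.find_spec hex) j
  have := hfix (t - Nat.find hex)
  rw [Nat.add_sub_cancel' (Nat.find_min' hex (by rw [h])), h] at this
  exact this.symm


/-- The instruction executing the token of index `c`. [folklore] -/
def execInstr (c : ℕ) : QInstr D.K (Option G.Op) :=
  match (tokOf c : Option (Tok G)) with
  | some Tok.qpush => QInstr.qpush false (D.addrA 0)
  | some Tok.rot => QInstr.qrot (D.addrA 0)
  | some Tok.swap => QInstr.qgate (none : Option G.Op) (D.addrA 0)
  | some (Tok.gate g) => QInstr.qgate (some g) (D.addrA 0)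
  | none => QInstr.goto (D.addrA 0)

/-- The four instructions of the decoding block of index `c`. [folklore] -/
def block (c : ℕ) : List (QInstr D.K (Option G.Op)) :=
  [QInstr.pop D.out fun o => match o with
      | none => D.addrR
      | some true => D.addrB c
      | some false => D.addrD c,
    QInstr.pop D.out fun _ => D.addrA (c + 1),
    QInstr.pop D.out fun _ => D.addrE c,
    D.execInstr c]

/-- The interpreter: the decoding blocks and the read-out. [cite: NishimuraOzawa2002, Lemma 5.1] -/
def interp : List (QInstr D.K (Option G.Op)) :=
  ((List.range (cmax G + 1)).flatMap D.block) ++ [QInstr.qread (D.addrR + 1)]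

/-- The length of the decoding blocks. [folklore] -/
theorem length_flatMap_block (l : List ℕ) : (l.flatMap D.block).length = 4 * l.length := by
  induction l with
  | nil => rfl
  | cons c l ih => rw [List.flatMap_cons, List.length_append, ih]; simp [block]; ring

/-- The length of the interpreter. [folklore] -/
theorem length_interp : D.interp.length = 4 * (cmax G + 1) + 1 := by
  rw [interp, List.length_append, length_flatMap_block, List.length_range, List.length_singleton]

/-- Indexing a `flatMap` of blocks of constant length. [folklore] -/
theorem getElem?_flatMap_const {α β : Type} (l : List α) (f : α → List β) (n : ℕ) (hf : ∀ a, (f a).length = n)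
    (c j : ℕ) (hc : c < l.length) (hj : j < n) : (l.flatMap f)[n * c + j]? = (f l[c])[j]? := by
  induction l generalizing c with
  | nil => simp at hc
  | cons a l ih =>
    rw [List.flatMap_cons]
    rcases c with _ | c
    · rw [Nat.mul_zero, Nat.zero_add, List.getElem?_append_left (by rw [hf]; exact hj)]; rfl
    · rw [List.getElem?_append_right (by rw [hf]; nlinarith), hf, show n * (c + 1) + j - n = n * c + j by
        rw [Nat.mul_succ]; omega, ih c (by simpa using hc)]
      rfl

/-- The `j`-th instruction of block `c`. [folklore] -/
theorem interp_block {c : ℕ} (hc : c ≤ cmax G) {j : ℕ} (hj : j < 4) : D.interp[4 * c + j]? = (D.block c)[j]? := by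
  rw [interp, List.getElem?_append_left (by rw [length_flatMap_block, List.length_range]; omega),
    getElem?_flatMap_const _ _ 4 (fun _ => rfl) c j (by simp; omega) hj, List.getElem_range]

variable [DecidableEq G.Op]

/-- **The executor program.** [cite: NishimuraOzawa2002, Lemma 5.1] -/
abbrev execProg (hG : G.IsUnitary) : Prog where
  K := D.K
  U := D.inp
  G := withSwap G
  unitary := withSwap_isUnitary G hG
  amax := amax G
  amax_pos := le_trans (by norm_num) (le_max_left _ _)
  arity_le := arity_le_amax
  code := [QInstr.goto 1, QInstr.pop D.inp fun _ => 2] ++ D.Pf.map D.trInstr ++ D.interp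
  code_head := rfl


/-- The length of the code. [folklore] -/
theorem L_execProg (hG : G.IsUnitary) : (D.execProg hG).L = D.addrR + 1 := by
  show ([QInstr.goto 1, QInstr.pop D.inp fun _ => 2] ++ D.Pf.map D.trInstr ++ D.interp).length = _
  rw [List.length_append, List.length_append, List.length_map, length_interp, addrR, base]
  simp; ring

/-! ### The instruction table -/

/-- The instruction at an address is the code at its value. [folklore] -/
theorem instr_eq (hG : G.IsUnitary) (i : (D.execProg hG).PC) : (D.execProg hG).instr i = (D.execProg hG).code[i.1]? := rfl

/-- Address `1`: `pop U`. [folklore] -/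
theorem code_one (hG : G.IsUnitary) : (D.execProg hG).code[1]? = some (QInstr.pop D.inp fun _ => 2) := rfl

/-- Addresses `2 … base - 1`: the flat program. [folklore] -/
theorem code_flat (hG : G.IsUnitary) {i : ℕ} {ins : AInstr Bool (Fin D.K)} (h : D.Pf[i]? = some ins) :
    (D.execProg hG).code[i + 2]? = some (D.trInstr ins) := by
  have hi : i < D.Pf.length := (List.getElem?_eq_some_iff.1 h).1
  show ([QInstr.goto 1, QInstr.pop D.inp fun _ => 2] ++ D.Pf.map D.trInstr ++ D.interp)[i + 2]? = _
  rw [List.append_assoc, List.getElem?_append_right (by simp)]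
  simp only [List.length_cons, List.length_nil, Nat.add_sub_cancel]
  rw [List.getElem?_append_left (by simpa using hi), List.getElem?_map, h, Option.map_some]

/-- The interpreter's code. [folklore] -/
theorem code_interp (hG : G.IsUnitary) (i : ℕ) : (D.execProg hG).code[D.base + i]? = D.interp[i]? := by
  show ([QInstr.goto 1, QInstr.pop D.inp fun _ => 2] ++ D.Pf.map D.trInstr ++ D.interp)[D.base + i]? = _
  rw [base, List.getElem?_append_right (by simp)]
  congr 1
  simp only [List.length_append, List.length_cons, List.length_nil, List.length_map]
  omega

/-- Address `A c`. [folklore] -/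
theorem code_A (hG : G.IsUnitary) {c : ℕ} (hc : c ≤ cmax G) : (D.execProg hG).code[D.addrA c]? =
    some (QInstr.pop D.out fun o => match o with | none => D.addrR | some true => D.addrB c | some false => D.addrD c) := by
  rw [addrA, show D.base + 4 * c = D.base + (4 * c + 0) by ring, D.code_interp hG _,
    D.interp_block hc (by norm_num)]; rfl

/-- Address `B c`. [folklore] -/
theorem code_B (hG : G.IsUnitary) {c : ℕ} (hc : c ≤ cmax G) : (D.execProg hG).code[D.addrB c]? = some (QInstr.pop D.out fun _ => D.addrA (c + 1)) := by
  rw [addrB, show D.base + 4 * c + 1 = D.base + (4 * c + 1) by ring, D.code_interp hG _,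
    D.interp_block hc (by norm_num)]; rfl

/-- Address `D c`. [folklore] -/
theorem code_D (hG : G.IsUnitary) {c : ℕ} (hc : c ≤ cmax G) : (D.execProg hG).code[D.addrD c]? = some (QInstr.pop D.out fun _ => D.addrE c) := by
  rw [addrD, show D.base + 4 * c + 2 = D.base + (4 * c + 2) by ring, D.code_interp hG _,
    D.interp_block hc (by norm_num)]; rfl

/-- Address `E c`. [folklore] -/
theorem code_E (hG : G.IsUnitary) {c : ℕ} (hc : c ≤ cmax G) : (D.execProg hG).code[D.addrE c]? = some (D.execInstr c) := by
  rw [addrE, show D.base + 4 * c + 3 = D.base + (4 * c + 3) by ring, D.code_interp hG _,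
    D.interp_block hc (by norm_num)]; rfl

/-- The read-out address. [folklore] -/
theorem code_R (hG : G.IsUnitary) : (D.execProg hG).code[D.addrR]? = some (QInstr.qread (D.addrR + 1)) := by
  rw [addrR, D.code_interp hG _, interp,
    List.getElem?_append_right (by rw [length_flatMap_block, List.length_range]), length_flatMap_block, List.length_range,
    Nat.sub_self]
  rfl

/-- Beyond the read-out: halted. [folklore] -/
theorem code_halt (hG : G.IsUnitary) : (D.execProg hG).code[D.addrR + 1]? = none := by
  rw [List.getElem?_eq_none_iff]
  have := D.L_execProg hG
  unfold Prog.L at this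
  omega

/-! ### Addresses -/

/-- Clamping an address of the code. [folklore] -/
theorem clamp_val (hG : G.IsUnitary) {a : ℕ} (h1 : 1 ≤ a) (hL : a ≤ D.addrR + 1) : ((D.execProg hG).clamp a).1 = a := by
  have := D.L_execProg hG
  simp only [Prog.clamp]
  omega

/-! ### The classical phase: one sweep per step of the flat program -/

section Flat

variable {D}

/-- **One sweep of the classical phase is one step of the flat program**: pending address
`pc + 2` with register file `R` becomes pending address `pc' + 2` with register file `R'`,
`⟨pc', R'⟩ = Pf.step ⟨pc, R⟩`, the queue untouched (for a step staying within the program or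
halting exactly at its end). [cite: AroraBarak2009, §1.4 (universal simulation step)] -/
theorem cstep_flat {hG : G.IsUnitary} {c : (D.execProg hG).Conf} {pc : ℕ} (hpc : pc < D.Pf.length)
    (hpend : (pend (D.execProg hG) c).1 = pc + 2) (hnext : (D.Pf.step ⟨pc, c.regs⟩).pc ≤ D.Pf.length) :
    (pend (D.execProg hG) (cstep (D.execProg hG) c)).1 = (D.Pf.step ⟨pc, c.regs⟩).pc + 2 ∧
      (cstep (D.execProg hG) c).regs = (D.Pf.step ⟨pc, c.regs⟩).regs ∧
      (cstep (D.execProg hG) c).queue = c.queue ∧ (cstep (D.execProg hG) c).dead = c.dead ∧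
      (cstep (D.execProg hG) c).parked = c.parked ∧
      (cstep (D.execProg hG) c).hist = c.hist ++ [(c.cur, c.res)] := by
  obtain ⟨ins, hins⟩ : ∃ ins, D.Pf[pc]? = some ins := ⟨D.Pf[pc], List.getElem?_eq_getElem hpc⟩
  have hcode := D.code_flat hG hins
  have hi : (D.execProg hG).instr (pend (D.execProg hG) c) = some (D.trInstr ins) := by
    rw [instr_eq, hpend, hcode]
  have hL := D.L_execProg hG
  have hb := D.base_le_addrR
  rw [AProg.step_of_getElem? _ hins] at hnext ⊢
  unfold cstep
  have hcur : ((D.execProg hG).commit c).cur = pend (D.execProg hG) c := rfl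
  simp only [hcur, hi]
  rcases ins with ⟨k, a⟩ | ⟨k, j⟩ | j <;> simp only [trInstr] at hnext ⊢
  · refine ⟨?_, rfl, rfl, rfl, rfl, rfl⟩
    show ((D.execProg hG).next (pend (D.execProg hG) c, PopRes.notpop)).1 = pc + 1 + 2
    unfold Prog.next
    rw [hi]
    simp only [trInstr]
    rw [hpend, D.clamp_val hG (by omega) (by unfold base at hb; omega)]
  · have hcr : ((D.execProg hG).commit c).regs = c.regs := rfl
    simp only [hcr]
    rcases hR : c.regs k with _ | ⟨a, w⟩
    · simp only [hR] at hnext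
      refine ⟨?_, ?_, rfl, rfl, rfl, rfl⟩
      · show ((D.execProg hG).next (pend (D.execProg hG) c, PopRes.popped ([] : List Bool).head?)).1 = j none + 2
        unfold Prog.next
        rw [hi]
        simp only [trInstr, List.head?_nil]
        rw [D.clamp_val hG (by omega) (by unfold base at hb; omega)]
      · show Function.update c.regs k ([] : List Bool).tail = c.regs
        rw [List.tail_nil, ← hR, Function.update_eq_self]
    · simp only [hR] at hnext
      refine ⟨?_, rfl, rfl, rfl, rfl, rfl⟩
      show ((D.execProg hG).next (pend (D.execProg hG) c, PopRes.popped (a :: w).head?)).1 = j (some a) + 2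
      unfold Prog.next
      rw [hi]
      simp only [trInstr, List.head?_cons]
      rw [D.clamp_val hG (by omega) (by unfold base at hb; omega)]
  · refine ⟨?_, rfl, rfl, rfl, rfl, rfl⟩
    show ((D.execProg hG).next (pend (D.execProg hG) c, PopRes.notpop)).1 = j + 2
    unfold Prog.next
    rw [hi]
    simp only [trInstr]
    rw [D.clamp_val hG (by omega) (by unfold base at hb; omega)]

/-- Flat instructions are classical. [folklore] -/
theorem classical_flat {hG : G.IsUnitary} {c : (D.execProg hG).Conf} {pc : ℕ} (hpc : pc < D.Pf.length)
    (hpend : (pend (D.execProg hG) c).1 = pc + 2) : Classical' (D.execProg hG) c := by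
  obtain ⟨ins, hins⟩ : ∃ ins, D.Pf[pc]? = some ins := ⟨D.Pf[pc], List.getElem?_eq_getElem hpc⟩
  have h : (D.execProg hG).instr (pend (D.execProg hG) c) = some (D.trInstr ins) := by rw [instr_eq, hpend, D.code_flat hG hins]
  rcases ins with ⟨k, a⟩ | ⟨k, j⟩ | j
  · exact Or.inr (Or.inl ⟨_, _, h⟩)
  · exact Or.inr (Or.inr (Or.inl ⟨_, _, h⟩))
  · exact Or.inr (Or.inr (Or.inr ⟨_, h⟩))

/-- **A run of the flat program staying inside it**: `t` steps from `⟨pc, R⟩`, all from addresses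
`< |Pf|`, ending at `⟨pc', R'⟩` with `pc' ≤ |Pf|`, are `t` sweeps of the machine. [cite: AroraBarak2009, §1.4] -/
theorem iterate_cstep_flat {hG : G.IsUnitary} (t : ℕ) :
    ∀ {c : (D.execProg hG).Conf} {pc : ℕ}, (pend (D.execProg hG) c).1 = pc + 2 →
      (∀ i < t, (D.Pf.step^[i] ⟨pc, c.regs⟩).pc < D.Pf.length) → (D.Pf.step^[t] ⟨pc, c.regs⟩).pc ≤ D.Pf.length →
      (pend (D.execProg hG) ((cstep (D.execProg hG))^[t] c)).1 = (D.Pf.step^[t] ⟨pc, c.regs⟩).pc + 2 ∧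
        ((cstep (D.execProg hG))^[t] c).regs = (D.Pf.step^[t] ⟨pc, c.regs⟩).regs ∧
        ((cstep (D.execProg hG))^[t] c).queue = c.queue ∧ ((cstep (D.execProg hG))^[t] c).dead = c.dead ∧
        ((cstep (D.execProg hG))^[t] c).parked = c.parked ∧
        ((cstep (D.execProg hG))^[t] c).hist.length = c.hist.length + t ∧
        (∀ i < t, Classical' (D.execProg hG) ((cstep (D.execProg hG))^[i] c)) := by
  induction t with
  | zero => intro c pc hpend _ _; exact ⟨hpend, rfl, rfl, rfl, rfl, rfl, fun i hi => absurd hi (Nat.not_lt_zero _)⟩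
  | succ t ih =>
    intro c pc hpend hlt hend
    have h0 : pc < D.Pf.length := by simpa using hlt 0 (Nat.zero_lt_succ _)
    -- the first step
    have hnext : (D.Pf.step ⟨pc, c.regs⟩).pc ≤ D.Pf.length := by
      rcases Nat.eq_zero_or_pos t with rfl | ht
      · simpa using hend
      · exact (by simpa [Function.iterate_succ_apply] using hlt 1 (by omega) : _ < _).le
    obtain ⟨h1, h2, h3, h4, h5, h6⟩ := cstep_flat h0 hpend hnext
    -- the remaining steps, from `cstep c`
    have hlt' : ∀ i < t, (D.Pf.step^[i] ⟨(D.Pf.step ⟨pc, c.regs⟩).pc, (cstep (D.execProg hG) c).regs⟩).pc < D.Pf.length := by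
      intro i hi
      have := hlt (i + 1) (by omega)
      rwa [Function.iterate_succ_apply, show D.Pf.step ⟨pc, c.regs⟩ = ⟨(D.Pf.step ⟨pc, c.regs⟩).pc, (cstep (D.execProg hG) c).regs⟩
        by rw [h2]] at this
    have hend' : (D.Pf.step^[t] ⟨(D.Pf.step ⟨pc, c.regs⟩).pc, (cstep (D.execProg hG) c).regs⟩).pc ≤ D.Pf.length := by
      rwa [Function.iterate_succ_apply, show D.Pf.step ⟨pc, c.regs⟩ = ⟨(D.Pf.step ⟨pc, c.regs⟩).pc, (cstep (D.execProg hG) c).regs⟩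
        by rw [h2]] at hend
    obtain ⟨g1, g2, g3, g4, g5, g6, g7⟩ := ih h1 hlt' hend'
    have hcfg : (⟨(D.Pf.step ⟨pc, c.regs⟩).pc, (cstep (D.execProg hG) c).regs⟩ : ACfg Bool (Fin D.K)) = D.Pf.step ⟨pc, c.regs⟩ := by
      rw [h2]
    simp only [Function.iterate_succ_apply, hcfg] at g1 g2 ⊢
    refine ⟨g1, g2, g3.trans h3, g4.trans h4, g5.trans h5, by rw [g6, h6]; simp; omega, fun i hi => ?_⟩
    rcases i with _ | i
    · exact classical_flat h0 hpend
    · rw [Function.iterate_succ_apply]; exact g7 i (by omega)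

end Flat

/-! ### The interpreter: decoding a token -/

section Interp

variable {D}

/-- A configuration pending at a `pop out` address of the interpreter is classical. [folklore] -/
theorem classical_of_code_pop {hG : G.IsUnitary} {cf : (D.execProg hG).Conf} {a : ℕ} {j : Option Bool → ℕ}
    (hpend : (pend (D.execProg hG) cf).1 = a) (hcode : (D.execProg hG).code[a]? = some (QInstr.pop D.out j)) :
    (D.execProg hG).instr (pend (D.execProg hG) cf) = some (QInstr.pop D.out j) := by
  rw [instr_eq, hpend, hcode]

/-- **Decoding**: from `A c` with `1^{2m} 0 1 w` in the output register, `2m + 2` classical sweeps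
lead to `E (c + m)` with `w` in the output register. [folklore] -/
theorem iterate_cstep_decode {hG : G.IsUnitary} (m : ℕ) : ∀ (c : ℕ) {cf : (D.execProg hG).Conf} (w : List Bool), c + m ≤ cmax G →
    (pend (D.execProg hG) cf).1 = D.addrA c → cf.regs D.out = List.replicate (2 * m) true ++ false :: true :: w →
    (pend (D.execProg hG) ((cstep (D.execProg hG))^[2 * m + 2] cf)).1 = D.addrE (c + m) ∧
      ((cstep (D.execProg hG))^[2 * m + 2] cf).regs = Function.update cf.regs D.out w ∧
      ((cstep (D.execProg hG))^[2 * m + 2] cf).queue = cf.queue ∧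
      ((cstep (D.execProg hG))^[2 * m + 2] cf).dead = cf.dead ∧
      ((cstep (D.execProg hG))^[2 * m + 2] cf).parked = cf.parked ∧
      ((cstep (D.execProg hG))^[2 * m + 2] cf).hist.length = cf.hist.length + (2 * m + 2) ∧
      (∀ i < 2 * m + 2, Classical' (D.execProg hG) ((cstep (D.execProg hG))^[i] cf)) := by
  have hL := D.L_execProg hG
  induction m with
  | zero =>
    intro c cf w hc hpend hout
    simp only [Nat.mul_zero, Nat.zero_add, Nat.add_zero, List.replicate_zero, List.nil_append] at hout hc ⊢
    -- sweep 1: `A c` pops `0`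
    have hi1 := classical_of_code_pop hpend (D.code_A hG hc)
    obtain ⟨h1, hp1⟩ := cstep_of_pop (D.execProg hG) hi1
    have hp1' : (pend (D.execProg hG) (cstep (D.execProg hG) cf)).1 = D.addrD c := by
      rw [hp1, hout]
      show ((D.execProg hG).clamp (D.addrD c)).1 = D.addrD c
      exact D.clamp_val hG (by unfold addrD base; omega) (by have := D.addrD_le hc; omega)
    -- sweep 2: `D c` pops `1`
    have hi2 := classical_of_code_pop hp1' (D.code_D hG hc)
    obtain ⟨h2, hp2⟩ := cstep_of_pop (D.execProg hG) hi2
    have hr1 : (cstep (D.execProg hG) cf).regs D.out = true :: w := by rw [h1]; simp [hout]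
    refine ⟨?_, ?_, ?_, ?_, ?_, ?_, ?_⟩
    · show (pend (D.execProg hG) (cstep (D.execProg hG) (cstep (D.execProg hG) cf))).1 = _
      rw [hp2]
      show ((D.execProg hG).clamp (D.addrE c)).1 = D.addrE c
      exact D.clamp_val hG (by unfold addrE base; omega) (by have := D.addrE_le hc; omega)
    · show (cstep (D.execProg hG) (cstep (D.execProg hG) cf)).regs = _
      rw [h2]; simp only [hr1, List.tail_cons]; rw [h1]; simp [hout]
    · show (cstep (D.execProg hG) (cstep (D.execProg hG) cf)).queue = _; rw [h2]; show (cstep _ cf).queue = _; rw [h1]; rfl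
    · show (cstep (D.execProg hG) (cstep (D.execProg hG) cf)).dead = _; rw [h2]; show (cstep _ cf).dead = _; rw [h1]; rfl
    · show (cstep (D.execProg hG) (cstep (D.execProg hG) cf)).parked = _; rw [h2]; show (cstep _ cf).parked = _; rw [h1]; rfl
    · exact length_hist_iterate_cstep _ 2 cf
    · intro i hi
      rcases i with _ | _ | i
      · exact Or.inr (Or.inr (Or.inl ⟨_, _, hi1⟩))
      · exact Or.inr (Or.inr (Or.inl ⟨_, _, hi2⟩))
      · omega
  | succ m ih =>
    intro c cf w hc hpend hout
    rw [show 2 * (m + 1) = 2 * m + 1 + 1 by ring, List.replicate_succ, List.replicate_succ] at hout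
    -- sweep 1: `A c` pops `1`
    have hi1 := classical_of_code_pop hpend (D.code_A hG (by omega))
    obtain ⟨h1, hp1⟩ := cstep_of_pop (D.execProg hG) hi1
    have hp1' : (pend (D.execProg hG) (cstep (D.execProg hG) cf)).1 = D.addrB c := by
      rw [hp1, hout]
      show ((D.execProg hG).clamp (D.addrB c)).1 = D.addrB c
      exact D.clamp_val hG (by unfold addrB base; omega) (by have := D.addrB_le (c := c) (by omega); omega)
    -- sweep 2: `B c` pops `1`
    have hi2 := classical_of_code_pop hp1' (D.code_B hG (by omega))
    obtain ⟨h2, hp2⟩ := cstep_of_pop (D.execProg hG) hi2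
    have hr1 : (cstep (D.execProg hG) cf).regs D.out = true :: (List.replicate (2 * m) true ++ false :: true :: w) := by
      rw [h1]; simp [hout]
    have hp2' : (pend (D.execProg hG) (cstep (D.execProg hG) (cstep (D.execProg hG) cf))).1 = D.addrA (c + 1) := by
      rw [hp2]
      exact D.clamp_val hG (by unfold addrA base; omega) (by have := D.addrA_le (c := c + 1) (by omega); omega)
    have hr2 : (cstep (D.execProg hG) (cstep (D.execProg hG) cf)).regs D.out = List.replicate (2 * m) true ++ false :: true :: w := by
      rw [h2]; simp [hr1]
    obtain ⟨g1, g2, g3, g4, g5, g6, g7⟩ := ih (c + 1) w (by omega) hp2' hr2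
    rw [show 2 * (m + 1) + 2 = (2 * m + 2) + 2 by ring, Function.iterate_add_apply,
      show (cstep (D.execProg hG))^[2] cf = cstep (D.execProg hG) (cstep (D.execProg hG) cf) from rfl]
    refine ⟨by rw [g1, show c + 1 + m = c + (m + 1) by ring], ?_, ?_, ?_, ?_, ?_, ?_⟩
    · rw [g2, h2]; simp only [hr1, List.tail_cons]; rw [Function.update_idem, h1]; simp
    · rw [g3, h2]; show (cstep _ cf).queue = _; rw [h1]; rfl
    · rw [g4, h2]; show (cstep _ cf).dead = _; rw [h1]; rfl
    · rw [g5, h2]; show (cstep _ cf).parked = _; rw [h1]; rfl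
    · rw [length_hist_iterate_cstep, length_hist_cstep, length_hist_cstep]; ring
    · intro i hi
      rcases i with _ | _ | i
      · exact Or.inr (Or.inr (Or.inl ⟨_, _, hi1⟩))
      · exact Or.inr (Or.inr (Or.inl ⟨_, _, hi2⟩))
      · rw [show i + 1 + 1 = i + 2 from rfl, Function.iterate_add_apply]
        exact g7 i (by omega)

omit [DecidableEq G.Op] in
/-- The instruction executing a token. [folklore] -/
theorem execInstr_idx (t : Tok G) : D.execInstr t.idx = (match t with
    | Tok.qpush => QInstr.qpush false (D.addrA 0)
    | Tok.rot => QInstr.qrot (D.addrA 0)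
    | Tok.swap => QInstr.qgate (none : Option G.Op) (D.addrA 0)
    | Tok.gate g => QInstr.qgate (some g) (D.addrA 0)) := by
  unfold execInstr
  rw [tokOf_idx]
  cases t <;> rfl

/-- The instruction pending at `E (idx t)`. [folklore] -/
theorem instr_of_pend_addrE {hG : G.IsUnitary} {cf : (D.execProg hG).Conf} (t : Tok G) (hpend : (pend (D.execProg hG) cf).1 = D.addrE t.idx) :
    (D.execProg hG).instr (pend (D.execProg hG) cf) = some (D.execInstr t.idx) := by
  rw [instr_eq, hpend, D.code_E hG t.idx_le]

/-- The continuation address of every token instruction is `A 0`. [folklore] -/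
theorem clamp_addrA_zero {hG : G.IsUnitary} : ((D.execProg hG).clamp (D.addrA 0)).1 = D.addrA 0 :=
  D.clamp_val hG (by unfold addrA base; omega) (by have := D.addrA_le (c := 0) (by omega); omega)

/-- The two front qubits as a register. [folklore] -/
theorem ofFn_swapReg_vecOf (a b : Bool) (r : List Bool) (h : ((a :: b :: r).take 2).length = 2) :
    List.ofFn (swapReg (vecOf ((a :: b :: r).take 2) h)) = [b, a] := by
  simp [swapReg, vecOf, List.ofFn_succ]

/-- **One token.** From the loop head `A 0` with `code (t :: toks)` in the output register, the
machine spends `cost t` sweeps and returns to `A 0` with `code toks`, the queue superposition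
transformed by `tokOp t` (classical decoding, then the one queue instruction; the gate sweep
superposes). [cite: NishimuraOzawa2002, Lemma 5.1] -/
theorem stepRun_token {hG : G.IsUnitary} (t : Tok G) (toks : List (Tok G)) {κ : (D.execProg hG).Conf} (Φ : List Bool →₀ ℂ) {N : ℕ}
    (hpend : (pend (D.execProg hG) κ).1 = D.addrA 0) (hout : κ.regs D.out = code (t :: toks))
    (hN : ∀ q ∈ Φ.support, q.length = N) (hok : t.OK N) :
    ∃ κ' : (D.execProg hG).Conf, (pend (D.execProg hG) κ').1 = D.addrA 0 ∧ κ'.regs = Function.update κ.regs D.out (code toks) ∧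
      κ'.parked = κ.parked ∧ κ'.hist.length = κ.hist.length + t.cost ∧ κ'.dead = κ.dead + t.deadInc ∧
      stepRun (D.execProg hG) t.cost (liftQ (D.execProg hG) κ Φ) = liftQ (D.execProg hG) κ' (tokOp t Φ) := by
  classical
  -- decoding
  rw [code_cons] at hout
  obtain ⟨g1, g2, g3, g4, g5, g6, g7⟩ := iterate_cstep_decode (D := D) (hG := hG) t.idx 0 (code toks) (by simpa using t.idx_le) hpend hout
  rw [Nat.zero_add] at g1
  have hphase1 : stepRun (D.execProg hG) (2 * t.idx + 2) (liftQ (D.execProg hG) κ Φ) =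
      liftQ (D.execProg hG) ((cstep (D.execProg hG))^[2 * t.idx + 2] κ) Φ :=
    stepRun_liftQ_classical _ _ κ g7 Φ
  rw [Tok.cost, show 2 * t.idx + 3 = (2 * t.idx + 2) + 1 by ring, stepRun_add_steps, hphase1]
  generalize (cstep (D.execProg hG))^[2 * t.idx + 2] κ = κ₁ at g1 g2 g3 g4 g5 g6
  have hi : ∀ q, (D.execProg hG).instr (pend (D.execProg hG) { κ₁ with queue := q }) = some (D.execInstr t.idx) := fun q =>
    instr_of_pend_addrE t g1
  have hcl := clamp_addrA_zero (D := D) (hG := hG)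
  show ∃ κ', _ ∧ _ ∧ _ ∧ _ ∧ _ ∧ bind (D.execProg hG) (liftQ (D.execProg hG) κ₁ Φ) = _
  rw [bind_liftQ]
  -- the queue instruction
  rcases t with _ | _ | _ | g
  · -- qpush
    refine ⟨{ (D.execProg hG).commit κ₁ with res := PopRes.notpop }, ?_, ?_, g5, ?_, g4, ?_⟩
    · show ((D.execProg hG).next (pend (D.execProg hG) κ₁, PopRes.notpop)).1 = _
      have := hi κ₁.queue; simp only [execInstr_idx] at this
      unfold Prog.next; rw [show pend (D.execProg hG) { κ₁ with queue := κ₁.queue } = pend (D.execProg hG) κ₁ from rfl] at this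
      rw [this]; exact hcl
    · exact g2
    · show (κ₁.hist ++ [_]).length = _; rw [List.length_append, g6, List.length_singleton]; ring
    · simp only [tokOp, liftQ_mapDomain]
      refine Finsupp.sum_congr fun q _ => ?_
      have hiq := hi q; simp only [execInstr_idx] at hiq
      obtain ⟨hc, -⟩ := cstep_of_qpush (D.execProg hG) hiq
      rw [bind_single_of_notGate _ (fun g j h => by rw [hiq] at h; cases h), hc]
      rfl
  · -- rot
    refine ⟨{ (D.execProg hG).commit κ₁ with res := PopRes.notpop, dead := κ₁.dead + 1 }, ?_, ?_, g5, ?_, by rw [g4]; rfl, ?_⟩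
    · show ((D.execProg hG).next (pend (D.execProg hG) κ₁, PopRes.notpop)).1 = _
      have := hi κ₁.queue; simp only [execInstr_idx] at this
      unfold Prog.next; rw [show pend (D.execProg hG) { κ₁ with queue := κ₁.queue } = pend (D.execProg hG) κ₁ from rfl] at this
      rw [this]; exact hcl
    · exact g2
    · show (κ₁.hist ++ [_]).length = _; rw [List.length_append, g6, List.length_singleton]; ring
    · simp only [tokOp, liftQ_mapDomain]
      refine Finsupp.sum_congr fun q _ => ?_
      have hiq := hi q; simp only [execInstr_idx] at hiq
      obtain ⟨hc, -⟩ := cstep_of_qrot (D.execProg hG) hiq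
      rw [bind_single_of_notGate _ (fun g j h => by rw [hiq] at h; cases h), hc]
      rfl
  · -- swap
    refine ⟨{ (D.execProg hG).commit κ₁ with res := PopRes.notpop }, ?_, ?_, g5, ?_, g4, ?_⟩
    · show ((D.execProg hG).next (pend (D.execProg hG) κ₁, PopRes.notpop)).1 = _
      have := hi κ₁.queue; simp only [execInstr_idx] at this
      unfold Prog.next; rw [show pend (D.execProg hG) { κ₁ with queue := κ₁.queue } = pend (D.execProg hG) κ₁ from rfl] at this
      rw [this]; exact hcl
    · exact g2
    · show (κ₁.hist ++ [_]).length = _; rw [List.length_append, g6, List.length_singleton]; ring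
    · simp only [tokOp, liftQ_mapDomain]
      refine Finsupp.sum_congr fun q hq => ?_
      have hiq := hi q; simp only [execInstr_idx] at hiq
      have hlen : 2 ≤ q.length := by rw [hN q hq]; exact hok
      obtain ⟨a, b, r, rfl⟩ : ∃ a b r, q = a :: b :: r := by
        rcases q with _ | ⟨a, _ | ⟨b, r⟩⟩ <;> simp at hlen; exact ⟨a, b, r, rfl⟩
      rw [bind_single, stepConf_of_qgate (D.execProg hG) hiq (by show 2 ≤ (a :: b :: r).length; simp)]
      show (∑ z : QReg 2, Finsupp.single
        ({ (D.execProg hG).commit { κ₁ with queue := a :: b :: r } with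
            res := PopRes.notpop, queue := List.ofFn z ++ (a :: b :: r).drop 2 } : (D.execProg hG).Conf)
          (swapGate z (vecOf ((a :: b :: r).take 2) (by simp)))).sum (fun c' m => Finsupp.single c' (Φ (a :: b :: r) * m)) = _
      -- only `z = swapReg (front pair)` contributes
      rw [Finset.sum_eq_single (swapReg (vecOf ((a :: b :: r).take 2) (by simp)))]
      · rw [swapGate_apply, if_pos rfl, Finsupp.sum_single_index (by simp), mul_one, ofFn_swapReg_vecOf]
        rfl
      · intro z _ hz
        rw [swapGate_apply, if_neg hz, Finsupp.single_zero]
      · intro h; exact absurd (Finset.mem_univ _) h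
  · -- gate
    refine ⟨{ (D.execProg hG).commit κ₁ with res := PopRes.notpop }, ?_, ?_, g5, ?_, g4, ?_⟩
    · show ((D.execProg hG).next (pend (D.execProg hG) κ₁, PopRes.notpop)).1 = _
      have := hi κ₁.queue; simp only [execInstr_idx] at this
      unfold Prog.next; rw [show pend (D.execProg hG) { κ₁ with queue := κ₁.queue } = pend (D.execProg hG) κ₁ from rfl] at this
      rw [this]; exact hcl
    · exact g2
    · show (κ₁.hist ++ [_]).length = _; rw [List.length_append, g6, List.length_singleton]; ring
    · simp only [tokOp, gateOp]
      rw [liftQ_sum]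
      refine Finsupp.sum_congr fun q hq => ?_
      have hiq := hi q; simp only [execInstr_idx] at hiq
      have hlen : G.arity g ≤ q.length := by rw [hN q hq]; exact hok.1
      rw [bind_single, stepConf_of_qgate (D.execProg hG) hiq hlen, ← Finsupp.sum_finsetSum_index (by simp) (by intros; simp [mul_add]),
        dif_pos hlen, liftQ_finset_sum]
      refine Finset.sum_congr rfl fun z _ => ?_
      rw [Finsupp.sum_single_index (by simp), liftQ_single]
      rfl

/-- **The shape condition of a token list** run on queues of length `N`. [folklore] -/
def _root_.Literature.Computability.QuantumComplexity.QSMExec.TokListOK : List (Tok G) → ℕ → Prop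
  | [], _ => True
  | t :: toks, N => t.OK N ∧ TokListOK toks (N + t.pushInc)

/-- The total number of sweeps of a token list. [folklore] -/
def _root_.Literature.Computability.QuantumComplexity.QSMExec.tokCost (toks : List (Tok G)) : ℕ := (toks.map Tok.cost).sum

/-- The total growth of the dead prefix. [folklore] -/
def _root_.Literature.Computability.QuantumComplexity.QSMExec.tokDead (toks : List (Tok G)) : ℕ := (toks.map Tok.deadInc).sum

/-- The total growth of the queue. [folklore] -/
def _root_.Literature.Computability.QuantumComplexity.QSMExec.tokPush (toks : List (Tok G)) : ℕ := (toks.map Tok.pushInc).sum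

omit [Fintype G.Op] [DecidableEq G.Op] in
/-- Token runs preserve "all queues have the same length". [folklore] -/
theorem _root_.Literature.Computability.QuantumComplexity.QSMExec.length_of_mem_support_tokRun (toks : List (Tok G)) :
    ∀ {Φ : List Bool →₀ ℂ} {N : ℕ}, (∀ q ∈ Φ.support, q.length = N) → TokListOK toks N →
      ∀ q ∈ (tokRun toks Φ).support, q.length = N + tokPush toks := by
  induction toks with
  | nil => intro Φ N hN _ q hq; simpa [tokPush] using hN q hq
  | cons t toks ih =>
    intro Φ N hN hok q hq
    have := ih (length_of_mem_support_tokOp t hN hok.1) hok.2 q hq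
    rw [this]; simp [tokPush]; ring

/-- **The interpreter on a token list.** [cite: NishimuraOzawa2002, Lemma 5.1] -/
theorem stepRun_tokens {hG : G.IsUnitary} (toks : List (Tok G)) :
    ∀ {κ : (D.execProg hG).Conf} (Φ : List Bool →₀ ℂ) {N : ℕ},
      (pend (D.execProg hG) κ).1 = D.addrA 0 → κ.regs D.out = code toks → (∀ q ∈ Φ.support, q.length = N) → TokListOK toks N →
      ∃ κ' : (D.execProg hG).Conf, (pend (D.execProg hG) κ').1 = D.addrA 0 ∧ κ'.regs = Function.update κ.regs D.out [] ∧
        κ'.parked = κ.parked ∧ κ'.hist.length = κ.hist.length + tokCost toks ∧ κ'.dead = κ.dead + tokDead toks ∧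
        stepRun (D.execProg hG) (tokCost toks) (liftQ (D.execProg hG) κ Φ) = liftQ (D.execProg hG) κ' (tokRun toks Φ) := by
  induction toks with
  | nil =>
    intro κ Φ N hpend hout _ _
    refine ⟨κ, hpend, ?_, rfl, by simp [tokCost], by simp [tokDead], rfl⟩
    rw [show ([] : List Bool) = code ([] : List (Tok G)) from rfl, ← hout, Function.update_eq_self]
  | cons t toks ih =>
    intro κ Φ N hpend hout hN hok
    obtain ⟨κ₁, h1, h2, h3, h4, h5, h6⟩ := stepRun_token t toks Φ hpend hout hN hok.1
    obtain ⟨κ₂, g1, g2, g3, g4, g5, g6⟩ := ih (κ := κ₁) (tokOp t Φ) h1 (by rw [h2]; simp)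
      (length_of_mem_support_tokOp t hN hok.1) hok.2
    refine ⟨κ₂, g1, by rw [g2, h2, Function.update_idem], g3.trans h3, by rw [g4, h4]; simp [tokCost]; ring,
      by rw [g5, h5]; simp [tokDead]; ring, ?_⟩
    rw [show tokCost (t :: toks) = t.cost + tokCost toks by simp [tokCost], stepRun_add_steps, h6, g6]
    rfl

/-! ### The read-out and the idle sweeps -/

/-- **The read-out**: from the loop head with an empty output register, the decoder jumps to the
read-out (one sweep) and `qread` parks the front qubit, halting (one sweep). [cite: NishimuraOzawa2002, Lemma 5.1] -/
theorem stepRun_readout {hG : G.IsUnitary} {κ : (D.execProg hG).Conf} (Φ : List Bool →₀ ℂ)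
    (hpend : (pend (D.execProg hG) κ).1 = D.addrA 0) (hout : κ.regs D.out = []) :
    ∃ κ' : (D.execProg hG).Conf, (pend (D.execProg hG) κ').1 = D.addrR + 1 ∧ κ'.cur.1 = D.addrR ∧ κ'.res = PopRes.notpop ∧
      κ'.regs = κ.regs ∧ κ'.hist.length = κ.hist.length + 2 ∧ κ'.dead = κ.dead + 1 ∧
      stepRun (D.execProg hG) 2 (liftQ (D.execProg hG) κ Φ) = liftQP (D.execProg hG) κ' Φ := by
  classical
  have hL := D.L_execProg hG
  -- sweep 1: `A 0` pops nothing
  have hi1 : (D.execProg hG).instr (pend (D.execProg hG) κ) = some _ := classical_of_code_pop hpend (D.code_A hG (Nat.zero_le _))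
  obtain ⟨hc1, hp1⟩ := cstep_of_pop (D.execProg hG) hi1
  have hp1' : (pend (D.execProg hG) (cstep (D.execProg hG) κ)).1 = D.addrR := by
    rw [hp1, hout]
    show ((D.execProg hG).clamp D.addrR).1 = D.addrR
    exact D.clamp_val hG (by have := D.base_le_addrR; have := D.two_le_base; omega) (by omega)
  have hcl1 : Classical' (D.execProg hG) κ := Or.inr (Or.inr (Or.inl ⟨_, _, hi1⟩))
  -- sweep 2: `qread`
  have hi2 : ∀ q, (D.execProg hG).instr (pend (D.execProg hG) { cstep (D.execProg hG) κ with queue := q }) =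
      some (QInstr.qread (D.addrR + 1)) := fun q => by rw [instr_eq]; show (D.execProg hG).code[(pend _ (cstep _ κ)).1]? = _; rw [hp1', D.code_R hG]
  refine ⟨{ (D.execProg hG).commit (cstep (D.execProg hG) κ) with res := PopRes.notpop, dead := (cstep (D.execProg hG) κ).dead + 1 },
    ?_, hp1', rfl, ?_, ?_, ?_, ?_⟩
  · show ((D.execProg hG).next (pend (D.execProg hG) (cstep (D.execProg hG) κ), PopRes.notpop)).1 = _
    unfold Prog.next
    rw [show pend (D.execProg hG) (cstep (D.execProg hG) κ) = pend (D.execProg hG) { cstep (D.execProg hG) κ with queue := [] } from rfl,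
      hi2 []]
    exact D.clamp_val hG (by omega) le_rfl
  · show (cstep (D.execProg hG) κ).regs = κ.regs
    rw [hc1]; show Function.update κ.regs D.out (κ.regs D.out).tail = κ.regs
    rw [hout, List.tail_nil, ← hout, Function.update_eq_self]
  · show ((cstep (D.execProg hG) κ).hist ++ [_]).length = _
    rw [List.length_append, length_hist_cstep]; rfl
  · show (cstep (D.execProg hG) κ).dead + 1 = _
    rw [hc1]; rfl
  · rw [show (2 : ℕ) = 1 + 1 from rfl, stepRun_add_steps,
      stepRun_liftQ_classical _ 1 κ (fun i hi => by rw [show i = 0 by omega]; exact hcl1) Φ]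
    show bind (D.execProg hG) (liftQ (D.execProg hG) (cstep (D.execProg hG) κ) Φ) = _
    rw [bind_liftQ, liftQP]
    refine Finsupp.sum_congr fun q _ => ?_
    obtain ⟨hc, -⟩ := cstep_of_qread (D.execProg hG) (hi2 q)
    rw [bind_single_of_notGate _ (fun g j h => by rw [hi2 q] at h; cases h), hc]
    rfl

/-- **Idle sweeps** keep a halted read-out lift halted, with the same register, queues and parked qubits. [folklore] -/
theorem stepRun_idle {hG : G.IsUnitary} (t : ℕ) : ∀ {κ : (D.execProg hG).Conf} (Φ : List Bool →₀ ℂ),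
    (pend (D.execProg hG) κ).1 = D.addrR + 1 →
    ∃ κ' : (D.execProg hG).Conf, (pend (D.execProg hG) κ').1 = D.addrR + 1 ∧ κ'.regs = κ.regs ∧
      κ'.hist.length = κ.hist.length + t ∧ κ'.dead = κ.dead ∧ (0 < t → κ'.cur.1 = D.addrR + 1 ∧ κ'.res = PopRes.notpop) ∧
      (t = 0 → κ' = κ) ∧
      stepRun (D.execProg hG) t (liftQP (D.execProg hG) κ Φ) = liftQP (D.execProg hG) κ' Φ := by
  classical
  induction t with
  | zero => intro κ Φ hpend; exact ⟨κ, hpend, rfl, rfl, rfl, fun h => absurd h (lt_irrefl 0), fun _ => rfl, rfl⟩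
  | succ t ih =>
    intro κ Φ hpend
    have hi : ∀ q p, (D.execProg hG).instr (pend (D.execProg hG) { κ with queue := q, parked := p }) = none := fun q p => by
      rw [instr_eq]; show (D.execProg hG).code[(pend _ κ).1]? = none; rw [hpend, D.code_halt hG]
    -- one idle sweep
    set κ₁ : (D.execProg hG).Conf := { (D.execProg hG).commit κ with res := PopRes.notpop } with hκ₁
    have hp1 : (pend (D.execProg hG) κ₁).1 = D.addrR + 1 := by
      show ((D.execProg hG).next (pend (D.execProg hG) κ, PopRes.notpop)).1 = _
      unfold Prog.next
      rw [show pend (D.execProg hG) κ = pend (D.execProg hG) { κ with queue := [], parked := [] } from rfl, hi [] []]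
      exact hpend
    have hstep : stepRun (D.execProg hG) 1 (liftQP (D.execProg hG) κ Φ) = liftQP (D.execProg hG) κ₁ Φ := by
      show bind (D.execProg hG) (liftQP (D.execProg hG) κ Φ) = _
      rw [liftQP, liftQP, Finsupp.sum, Finsupp.sum]
      refine (map_sum (⟨⟨bind _, bind_zero _⟩, bind_add _⟩ : (_ →₀ ℂ) →+ (_ →₀ ℂ)) _ _).trans (Finset.sum_congr rfl fun q _ => ?_)
      show bind (D.execProg hG) (Finsupp.single _ _) = _
      obtain ⟨hc, -⟩ := cstep_of_none (D.execProg hG) (hi q.tail (q.take 1))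
      rw [bind_single_of_notGate _ (fun g j h => by rw [hi] at h; cases h), hc]
      rfl
    obtain ⟨κ', g1, g2, g3, g4, g5, g6, g7⟩ := ih (κ := κ₁) Φ hp1
    refine ⟨κ', g1, g2, by rw [g3]; show (κ.hist ++ [_]).length + t = _; simp; ring, g4, fun _ => ?_, fun h => absurd h (Nat.succ_ne_zero _), ?_⟩
    · rcases Nat.eq_zero_or_pos t with rfl | ht
      · rw [g6 rfl]; exact ⟨hpend, rfl⟩
      · exact g5 ht
    · rw [show t + 1 = 1 + t by ring, stepRun_add_steps, hstep, g7]

/-! ### The whole run -/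

/-- **Sweep 1**: the input register loses one `1` and the flat program is entered at its address `0`. [folklore] -/
theorem cstep_conf₁ {hG : G.IsUnitary} (x : List Bool) :
    (pend (D.execProg hG) (cstep (D.execProg hG) ((D.execProg hG).conf₁ x))).1 = 0 + 2 ∧
      (cstep (D.execProg hG) ((D.execProg hG).conf₁ x)).regs = AStore.single D.inp (List.replicate x.length true) ∧
      (cstep (D.execProg hG) ((D.execProg hG).conf₁ x)).queue = x ++ [false] ∧
      (cstep (D.execProg hG) ((D.execProg hG).conf₁ x)).dead = 0 ∧
      (cstep (D.execProg hG) ((D.execProg hG).conf₁ x)).parked = [] ∧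
      (cstep (D.execProg hG) ((D.execProg hG).conf₁ x)).hist.length = 1 ∧
      Classical' (D.execProg hG) ((D.execProg hG).conf₁ x) := by
  have hL := D.L_execProg hG
  have hpend : (pend (D.execProg hG) ((D.execProg hG).conf₁ x)).1 = 1 := by
    show ((D.execProg hG).next (0, PopRes.notpop)).1 = 1
    unfold Prog.next
    rw [(D.execProg hG).instr_zero]
    exact D.clamp_val hG le_rfl (by omega)
  have hi : (D.execProg hG).instr (pend (D.execProg hG) ((D.execProg hG).conf₁ x)) = some (QInstr.pop D.inp fun _ => 2) := by
    rw [instr_eq, hpend]; rfl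
  obtain ⟨hc, hp⟩ := cstep_of_pop (D.execProg hG) hi
  have hU : ((D.execProg hG).conf₁ x).regs D.inp = List.replicate (x.length + 1) true := by simp [conf₁]
  refine ⟨?_, ?_, by rw [hc]; rfl, by rw [hc]; rfl, by rw [hc]; rfl, by rw [hc]; rfl, Or.inr (Or.inr (Or.inl ⟨_, _, hi⟩))⟩
  · rw [hp]; exact D.clamp_val hG (by omega) (by have := D.two_le_base; have := D.base_le_addrR; omega)
  · rw [hc]
    show Function.update ((D.execProg hG).conf₁ x).regs D.inp (((D.execProg hG).conf₁ x).regs D.inp).tail = _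
    funext k
    by_cases hk : k = D.inp
    · subst hk; simp [hU, AStore.single]
    · rw [Function.update_of_ne hk, AStore.single_of_ne hk]; simp [conf₁]; intro h; exact absurd h hk

/-- The first configuration as a lift. [folklore] -/
theorem liftQ_conf₁ {hG : G.IsUnitary} (x : List Bool) :
    liftQ (D.execProg hG) ((D.execProg hG).conf₁ x) (Finsupp.single (x ++ [false]) 1) = Finsupp.single ((D.execProg hG).conf₁ x) 1 := by
  rw [liftQ_single]; rfl

/-- **The accepting weight of a read-out lift** of a halted control state: the Born weight of
`head = 1`. [folklore] -/
theorem acceptWeight_liftQP {hG : G.IsUnitary} {κ : (D.execProg hG).Conf} (hcur : κ.cur.1 = D.addrR + 1) (hres : κ.res = PopRes.notpop)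
    (Φ : List Bool →₀ ℂ) :
    ((liftQP (D.execProg hG) κ Φ).sum fun c a =>
        if c.cur = Fin.last _ ∧ c.res = PopRes.notpop ∧ c.parked = [true] then ‖a‖ ^ 2 else 0) =
      Φ.sum fun q a => if q.head? = some true then ‖a‖ ^ 2 else 0 := by
  classical
  have hinj : Function.Injective fun q : List Bool => ({ κ with queue := q.tail, parked := q.take 1 } : (D.execProg hG).Conf) := by
    intro q q' h
    simp only [Conf.mk.injEq, true_and] at h
    rw [← List.take_append_drop 1 q, ← List.take_append_drop 1 q', List.drop_one, List.drop_one, h.1, h.2]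
  rw [liftQP, show (Φ.sum fun q a => Finsupp.single ({ κ with queue := q.tail, parked := q.take 1 } : (D.execProg hG).Conf) a) =
      Finsupp.mapDomain (fun q : List Bool => ({ κ with queue := q.tail, parked := q.take 1 } : (D.execProg hG).Conf)) Φ from rfl,
    Finsupp.sum_mapDomain_index_inj hinj]
  refine Finsupp.sum_congr fun q _ => ?_
  have hL := D.L_execProg hG
  have hcur' : κ.cur = Fin.last _ := Fin.ext (by rw [hcur]; simp [hL])
  simp only [hcur', hres, true_and]
  congr 1
  rcases q with _ | ⟨b, q⟩
  · simp
  · cases b <;> simp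

/-- **The executor theorem.** If the flat program, started on `1ⁿ`, halts with the token code of
`toks` in its output register within `tf` steps, and the tokens fit the queue, then from
`tf + tokCost toks + 4` sweeps on, the accepting weight of the abstract run of the executor on `x`
(`|x| = n`) is the Born weight of `head = 1` in the token run of `|x 0⟩`. [cite: NishimuraOzawa2002, Lemma 5.1] -/
theorem acceptWeight_confRun {hG : G.IsUnitary} (x : List Bool) (toks : List (Tok G)) {tf : ℕ}
    (hPf : D.Pf.step^[tf] ⟨0, AStore.single D.inp (List.replicate x.length true)⟩ = ⟨D.Pf.length, AStore.single D.out (code toks)⟩)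
    (hok : TokListOK toks (x.length + 1)) {s : ℕ} (hs : tf + tokCost toks + 4 ≤ s) :
    (((D.execProg hG).confRun x s).sum fun c a =>
        if c.cur = Fin.last _ ∧ c.res = PopRes.notpop ∧ c.parked = [true] then ‖a‖ ^ 2 else 0) =
      (tokRun toks (Finsupp.single (x ++ [false]) 1)).sum fun q a => if q.head? = some true then ‖a‖ ^ 2 else 0 := by
  classical
  -- sweep 1
  obtain ⟨b1, b2, b3, b4, b5, b6, b7⟩ := cstep_conf₁ (D := D) (hG := hG) x
  -- the classical phase
  obtain ⟨t₀, ht₀, hrun, hlt⟩ := D.exists_first_halt hPf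
  have hlt' : ∀ i < t₀, (D.Pf.step^[i] ⟨0, (cstep (D.execProg hG) ((D.execProg hG).conf₁ x)).regs⟩).pc < D.Pf.length := by
    rw [b2]; exact hlt
  have hend : (D.Pf.step^[t₀] ⟨0, (cstep (D.execProg hG) ((D.execProg hG).conf₁ x)).regs⟩).pc ≤ D.Pf.length := by
    rw [b2, hrun]
  obtain ⟨f1, f2, f3, f4, f5, f6, f7⟩ := iterate_cstep_flat (D := D) (hG := hG) t₀ b1 hlt' hend
  rw [b2, hrun] at f1 f2
  simp only at f1 f2
  -- the tokens
  set κf := (cstep (D.execProg hG))^[t₀] (cstep (D.execProg hG) ((D.execProg hG).conf₁ x)) with hκf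
  have hpendf : (pend (D.execProg hG) κf).1 = D.addrA 0 := by rw [f1]; rfl
  have houtf : κf.regs D.out = code toks := by rw [f2]; simp [AStore.single]
  obtain ⟨κt, t1, t2, t3, t4, t5, t6⟩ := stepRun_tokens (D := D) (hG := hG) toks (κ := κf) (Finsupp.single (x ++ [false]) 1) (N := x.length + 1)
    hpendf houtf (fun q hq => by have := Finsupp.support_single_subset hq; simp at this; simp [this]) hok
  -- the read-out
  obtain ⟨κr, r1, r2, r3, r4, r5, r6, r7⟩ := stepRun_readout (D := D) (hG := hG) (tokRun toks (Finsupp.single (x ++ [false]) 1)) t1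
    (by rw [t2]; simp)
  -- the idle sweeps
  obtain ⟨κi, i1, i2, i3, i4, i5, -, i7⟩ := stepRun_idle (D := D) (hG := hG) (s - (1 + t₀ + tokCost toks + 2)) (tokRun toks (Finsupp.single (x ++ [false]) 1)) r1
  -- assembling the run
  have hrun : (D.execProg hG).confRun x s = liftQP (D.execProg hG) κi (tokRun toks (Finsupp.single (x ++ [false]) 1)) := by
    rw [confRun_eq_stepRun, show s = 1 + t₀ + tokCost toks + 2 + (s - (1 + t₀ + tokCost toks + 2)) by omega,
      stepRun_add_steps, stepRun_add_steps, stepRun_add_steps, stepRun_add_steps, ← liftQ_conf₁,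
      stepRun_liftQ_classical _ 1 _ (fun i hi => by rw [show i = 0 by omega]; exact b7),
      Function.iterate_one, stepRun_liftQ_classical _ t₀ _ f7, ← hκf, t6, r7, i7]
  rw [hrun]
  exact acceptWeight_liftQP (i5 (by omega)).1 (i5 (by omega)).2 _

/-! ### Bounds along the run -/

/-- Supports of the abstract run, unfolded one sweep. [folklore] -/
theorem mem_support_confRun_succ {hG : G.IsUnitary} {x : List Bool} {s : ℕ} {c' : (D.execProg hG).Conf}
    (h : c' ∈ ((D.execProg hG).confRun x (s + 1)).support) :
    ∃ c ∈ ((D.execProg hG).confRun x s).support, c' ∈ ((D.execProg hG).stepConf c).support := by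
  rw [confRun_eq_stepRun] at h ⊢
  exact mem_support_bind _ h

/-- **Growth bounds along the run**: history `s`, at most one parked qubit, and from sweep `1`
on every register and the queue region within `n + s`. [folklore] -/
theorem bounds_confRun {hG : G.IsUnitary} (x : List Bool) : ∀ (s : ℕ) (c : (D.execProg hG).Conf), c ∈ ((D.execProg hG).confRun x s).support →
    c.hist.length = s ∧ c.parked.length ≤ 1 ∧
      (1 ≤ s → (∀ k, (c.regs k).length ≤ x.length + s) ∧ c.dead + c.queue.length ≤ x.length + s) := by
  classical
  intro s
  induction s with
  | zero =>
    intro c hc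
    have := Finsupp.support_single_subset (show c ∈ (Finsupp.single ((D.execProg hG).conf₁ x) (1 : ℂ)).support from hc)
    simp only [Finset.mem_singleton] at this
    subst this
    exact ⟨rfl, by simp [conf₁], fun h => absurd h (by omega)⟩
  | succ s ih =>
    intro c hc
    obtain ⟨c₀, hc₀, hstep⟩ := mem_support_confRun_succ (D := D) (hG := hG) hc
    obtain ⟨g1, g2, g3, g4⟩ := growth_of_mem_support_stepConf _ hstep
    obtain ⟨i1, i2, i3⟩ := ih c₀ hc₀
    refine ⟨by rw [g1, i1], g2.trans (max_le i2 le_rfl), fun _ => ?_⟩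
    rcases Nat.eq_zero_or_pos s with rfl | hs
    · -- sweep 1: `c₀ = conf₁ x`, `c = cstep (conf₁ x)`
      have h0 := Finsupp.support_single_subset (show c₀ ∈ (Finsupp.single ((D.execProg hG).conf₁ x) (1 : ℂ)).support from hc₀)
      simp only [Finset.mem_singleton] at h0
      subst h0
      obtain ⟨-, b2, b3, b4, -, -, b7⟩ := cstep_conf₁ (D := D) (hG := hG) x
      rw [stepConf_of_notGate _ (notGate_of_classical _ b7)] at hstep
      have := Finsupp.support_single_subset hstep
      simp only [Finset.mem_singleton] at this
      subst this
      refine ⟨fun k => ?_, by rw [b3, b4]; simp⟩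
      rw [b2]; simp only [AStore.single]; split_ifs <;> simp
    · obtain ⟨j1, j2⟩ := i3 hs
      exact ⟨fun k => (g3 k).trans (by have := j1 k; omega), g4.trans (by omega)⟩

/-- **`StepOK` from the shape conditions**: with the growth bounds, a configuration of the run
whose pending queue instruction has its shape conditions satisfies all the hypotheses of the
simulation theorem. [folklore] -/
theorem stepOK_of_qShape {hG : G.IsUnitary} (x : List Bool) {s : ℕ} {c : (D.execProg hG).Conf} (hc : c ∈ ((D.execProg hG).confRun x s).support)
    (hq : QShape (D.execProg hG) c) : (D.execProg hG).StepOK x.length (s + 1) c := by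
  classical
  obtain ⟨b1, b2, b3⟩ := bounds_confRun (D := D) (hG := hG) x s c hc
  have hamax : 1 ≤ (D.execProg hG).amax := le_trans (by norm_num) (le_max_left _ _)
  rcases Nat.eq_zero_or_pos s with rfl | hs
  · -- sweep 1: the configuration is `conf₁ x`, the instruction `pop U`
    have := Finsupp.support_single_subset (show c ∈ (Finsupp.single ((D.execProg hG).conf₁ x) (1 : ℂ)).support from hc)
    simp only [Finset.mem_singleton] at this
    subst this
    obtain ⟨-, -, -, -, -, -, b7⟩ := cstep_conf₁ (D := D) (hG := hG) x
    have hcl : ∀ {ins}, (D.execProg hG).instr ((D.execProg hG).next (((D.execProg hG).conf₁ x).cur, ((D.execProg hG).conf₁ x).res)) = some ins →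
        (∃ k j, ins = QInstr.pop k j) := by
      intro ins h
      have hi : (D.execProg hG).instr (pend (D.execProg hG) ((D.execProg hG).conf₁ x)) = some (QInstr.pop D.inp fun _ => 2) := by
        have hL := D.L_execProg hG
        have hpend : (pend (D.execProg hG) ((D.execProg hG).conf₁ x)).1 = 1 := by
          show ((D.execProg hG).next (0, PopRes.notpop)).1 = 1
          unfold Prog.next; rw [(D.execProg hG).instr_zero]; exact D.clamp_val hG le_rfl (by omega)
        rw [instr_eq, hpend]; rfl
      rw [show (D.execProg hG).next (((D.execProg hG).conf₁ x).cur, ((D.execProg hG).conf₁ x).res) = pend (D.execProg hG) ((D.execProg hG).conf₁ x)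
        from rfl, hi] at h
      cases h; exact ⟨_, _, rfl⟩
    refine ⟨⟨le_rfl, by simp [conf₁], fun k => by simp [conf₁]; split_ifs <;> simp, by simp [conf₁], by simp [conf₁]⟩,
      fun k b h => ?_, fun b j h => ?_, fun j h => ?_, fun g j h => ?_, fun j h => ?_⟩ <;>
      obtain ⟨k', j', hk⟩ := hcl h <;> cases hk
  · obtain ⟨r1, r2⟩ := b3 hs
    obtain ⟨q1, q2, q3⟩ := hq
    refine ⟨⟨by omega, by omega, fun k => by have := r1 k; omega, by rw [b1]; rfl, b2.trans hamax⟩,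
      fun k b _ => by have := r1 k; omega, fun b j _ => by omega, fun j h => ⟨q1 j h, by omega⟩, fun g j h => q2 g j h,
      fun j h => q3 j h⟩

/-! ### The shape conditions along the run -/

/-- A token-executing lift is good. [folklore] -/
theorem goodV_liftQ_token {hG : G.IsUnitary} (t : Tok G) {κ : (D.execProg hG).Conf} {Φ : List Bool →₀ ℂ} {N : ℕ}
    (hpend : (pend (D.execProg hG) κ).1 = D.addrE t.idx) (hpk : κ.parked = []) (hN : ∀ q ∈ Φ.support, q.length = N)
    (hok : t.OK N) : GoodV (D.execProg hG) (liftQ (D.execProg hG) κ Φ) := by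
  classical
  intro c hc
  rw [liftQ] at hc
  obtain ⟨q, hq, hq'⟩ := Finset.mem_biUnion.1 (Finsupp.support_sum hc)
  have := Finsupp.support_single_subset hq'
  simp only [Finset.mem_singleton] at this
  subst this
  have hi : (D.execProg hG).instr (pend (D.execProg hG) { κ with queue := q }) = some (D.execInstr t.idx) := instr_of_pend_addrE t hpend
  rw [execInstr_idx] at hi
  have hlen := hN q hq
  have hne : 1 ≤ N → q ≠ [] := fun h1 h => by subst h; simp at hlen; omega
  refine ⟨fun j hj => ?_, fun g j hj => ?_, fun j hj => ?_⟩ <;> rw [hi] at hj <;> rcases t with _ | _ | _ | g' <;> cases hj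
  · exact hne hok
  · exact ⟨hpk, hne (le_trans (by norm_num) hok), by show 2 ≤ q.length; rw [hlen]; exact hok⟩
  · exact ⟨hpk, hne hok.2, by show G.arity g' ≤ q.length; rw [hlen]; exact hok.1⟩

/-- **The shape conditions during a token.** [folklore] -/
theorem goodV_token {hG : G.IsUnitary} (t : Tok G) (toks : List (Tok G)) {κ : (D.execProg hG).Conf} (Φ : List Bool →₀ ℂ) {N : ℕ}
    (hpend : (pend (D.execProg hG) κ).1 = D.addrA 0) (hout : κ.regs D.out = code (t :: toks)) (hpk : κ.parked = [])
    (hN : ∀ q ∈ Φ.support, q.length = N) (hok : t.OK N) :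
    ∀ i < t.cost, GoodV (D.execProg hG) (stepRun (D.execProg hG) i (liftQ (D.execProg hG) κ Φ)) := by
  intro i hi
  rw [code_cons] at hout
  obtain ⟨g1, -, -, -, g5, -, g7⟩ := iterate_cstep_decode (D := D) (hG := hG) t.idx 0 (code toks) (by simpa using t.idx_le) hpend hout
  rcases (show i < 2 * t.idx + 2 ∨ i = 2 * t.idx + 2 by simp [Tok.cost] at hi; omega) with hlt | rfl
  · rw [stepRun_liftQ_classical _ i κ (fun j hj => g7 j (by omega))]
    exact goodV_liftQ_of_classical _ (g7 i hlt) Φ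
  · rw [stepRun_liftQ_classical _ _ κ g7]
    rw [Nat.zero_add] at g1
    exact goodV_liftQ_token (D := D) (hG := hG) t g1 (g5.trans hpk) hN hok

/-- **The shape conditions during a token list.** [folklore] -/
theorem goodV_tokens {hG : G.IsUnitary} (toks : List (Tok G)) : ∀ {κ : (D.execProg hG).Conf} (Φ : List Bool →₀ ℂ) {N : ℕ},
    (pend (D.execProg hG) κ).1 = D.addrA 0 → κ.regs D.out = code toks → κ.parked = [] → (∀ q ∈ Φ.support, q.length = N) →
    TokListOK toks N → ∀ i < tokCost toks, GoodV (D.execProg hG) (stepRun (D.execProg hG) i (liftQ (D.execProg hG) κ Φ)) := by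
  induction toks with
  | nil => intro κ Φ N _ _ _ _ _ i hi; simp [tokCost] at hi
  | cons t toks ih =>
    intro κ Φ N hpend hout hpk hN hok i hi
    rcases Nat.lt_or_ge i t.cost with hlt | hle
    · exact goodV_token (D := D) (hG := hG) t toks Φ hpend hout hpk hN hok.1 i hlt
    · obtain ⟨κ₁, h1, h2, h3, -, -, h6⟩ := stepRun_token (D := D) (hG := hG) t toks Φ hpend hout hN hok.1
      rw [show i = t.cost + (i - t.cost) by omega, stepRun_add_steps, h6]
      exact ih (tokOp t Φ) h1 (by rw [h2]; simp) (h3.trans hpk) (length_of_mem_support_tokOp t hN hok.1) hok.2 _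
        (by simp [tokCost] at hi ⊢; omega)

/-- **The shape conditions hold along the whole run of the executor.** [folklore] -/
theorem goodV_confRun {hG : G.IsUnitary} (x : List Bool) (toks : List (Tok G)) {tf : ℕ}
    (hPf : D.Pf.step^[tf] ⟨0, AStore.single D.inp (List.replicate x.length true)⟩ = ⟨D.Pf.length, AStore.single D.out (code toks)⟩)
    (hok : TokListOK toks (x.length + 1)) (s : ℕ) : GoodV (D.execProg hG) ((D.execProg hG).confRun x s) := by
  classical
  have hL := D.L_execProg hG
  obtain ⟨b1, b2, b3, b4, b5, b6, b7⟩ := cstep_conf₁ (D := D) (hG := hG) x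
  obtain ⟨t₀, ht₀, hrun, hlt⟩ := D.exists_first_halt hPf
  have hlt' : ∀ i < t₀, (D.Pf.step^[i] ⟨0, (cstep (D.execProg hG) ((D.execProg hG).conf₁ x)).regs⟩).pc < D.Pf.length := by
    rw [b2]; exact hlt
  have hend : (D.Pf.step^[t₀] ⟨0, (cstep (D.execProg hG) ((D.execProg hG).conf₁ x)).regs⟩).pc ≤ D.Pf.length := by
    rw [b2, hrun]
  obtain ⟨f1, f2, f3, f4, f5, f6, f7⟩ := iterate_cstep_flat (D := D) (hG := hG) t₀ b1 hlt' hend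
  rw [b2, hrun] at f1 f2
  simp only at f1 f2
  set κf := (cstep (D.execProg hG))^[t₀] (cstep (D.execProg hG) ((D.execProg hG).conf₁ x)) with hκf
  have hpendf : (pend (D.execProg hG) κf).1 = D.addrA 0 := by rw [f1]; rfl
  have houtf : κf.regs D.out = code toks := by rw [f2]; simp [AStore.single]
  have hpkf : κf.parked = [] := f5.trans b5
  have hN0 : ∀ q ∈ (Finsupp.single (x ++ [false]) (1 : ℂ)).support, q.length = x.length + 1 := fun q hq => by
    have := Finsupp.support_single_subset hq; simp at this; simp [this]
  obtain ⟨κt, t1, t2, t3, t4, t5, t6⟩ := stepRun_tokens (D := D) (hG := hG) toks (κ := κf) (Finsupp.single (x ++ [false]) 1)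
    hpendf houtf hN0 hok
  -- the read-out, step by step
  have houtt : κt.regs D.out = [] := by rw [t2]; simp
  have hit : (D.execProg hG).instr (pend (D.execProg hG) κt) = some _ := classical_of_code_pop t1 (D.code_A hG (Nat.zero_le _))
  have hclt : Classical' (D.execProg hG) κt := Or.inr (Or.inr (Or.inl ⟨_, _, hit⟩))
  obtain ⟨hct, hpt⟩ := cstep_of_pop (D.execProg hG) hit
  have hpt' : (pend (D.execProg hG) (cstep (D.execProg hG) κt)).1 = D.addrR := by
    rw [hpt, houtt]
    show ((D.execProg hG).clamp D.addrR).1 = D.addrR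
    exact D.clamp_val hG (by have := D.base_le_addrR; have := D.two_le_base; omega) (by omega)
  obtain ⟨κr, r1, -, -, -, -, -, r7⟩ := stepRun_readout (D := D) (hG := hG) (tokRun toks (Finsupp.single (x ++ [false]) 1)) t1 houtt
  -- locating `s`
  have hstart : (D.execProg hG).confRun x 0 = liftQ (D.execProg hG) ((D.execProg hG).conf₁ x) (Finsupp.single (x ++ [false]) 1) := by
    rw [liftQ_conf₁]; rfl
  have hat : ∀ i, (D.execProg hG).confRun x i = stepRun (D.execProg hG) i (liftQ (D.execProg hG) ((D.execProg hG).conf₁ x) (Finsupp.single (x ++ [false]) 1)) :=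
    fun i => by rw [confRun_eq_stepRun, ← liftQ_conf₁]
  rcases Nat.eq_zero_or_pos s with rfl | hs1
  · rw [hstart]; exact goodV_liftQ_of_classical _ b7 _
  have hs1' : (D.execProg hG).confRun x s = stepRun (D.execProg hG) (s - 1)
      (liftQ (D.execProg hG) (cstep (D.execProg hG) ((D.execProg hG).conf₁ x)) (Finsupp.single (x ++ [false]) 1)) := by
    rw [hat, show s = 1 + (s - 1) by omega, stepRun_add_steps,
      stepRun_liftQ_classical _ 1 _ (fun i hi => by rw [show i = 0 by omega]; exact b7)]
    simp
  rcases Nat.lt_or_ge (s - 1) t₀ with hlt₀ | hge₀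
  · -- inside the classical phase
    rw [hs1', stepRun_liftQ_classical _ (s - 1) _ (fun i hi => f7 i (by omega))]
    exact goodV_liftQ_of_classical _ (f7 _ hlt₀) _
  have hs2 : (D.execProg hG).confRun x s = stepRun (D.execProg hG) (s - 1 - t₀) (liftQ (D.execProg hG) κf (Finsupp.single (x ++ [false]) 1)) := by
    rw [hs1', show s - 1 = t₀ + (s - 1 - t₀) by omega, stepRun_add_steps, stepRun_liftQ_classical _ t₀ _ f7, Nat.add_sub_cancel_left]
  rcases Nat.lt_or_ge (s - 1 - t₀) (tokCost toks) with hlt₁ | hge₁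
  · -- inside the tokens
    rw [hs2]; exact goodV_tokens (D := D) (hG := hG) toks _ hpendf houtf hpkf hN0 hok _ hlt₁
  have hs3 : (D.execProg hG).confRun x s = stepRun (D.execProg hG) (s - 1 - t₀ - tokCost toks)
      (liftQ (D.execProg hG) κt (tokRun toks (Finsupp.single (x ++ [false]) 1))) := by
    rw [hs2, show s - 1 - t₀ = tokCost toks + (s - 1 - t₀ - tokCost toks) by omega, stepRun_add_steps, t6, Nat.add_sub_cancel_left]
  rcases Nat.lt_or_ge (s - 1 - t₀ - tokCost toks) 2 with hlt₂ | hge₂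
  · rw [hs3]
    rcases (show s - 1 - t₀ - tokCost toks = 0 ∨ s - 1 - t₀ - tokCost toks = 1 by omega) with h0 | h1
    · rw [h0]; exact goodV_liftQ_of_classical _ hclt _
    · rw [h1, stepRun_liftQ_classical _ 1 _ (fun i hi => by rw [show i = 0 by omega]; exact hclt), Function.iterate_one]
      -- the `qread` sweep
      intro c hc
      rw [liftQ] at hc
      obtain ⟨q, hq, hq'⟩ := Finset.mem_biUnion.1 (Finsupp.support_sum hc)
      have := Finsupp.support_single_subset hq'
      simp only [Finset.mem_singleton] at this
      subst this
      have hi : (D.execProg hG).instr (pend (D.execProg hG) { cstep (D.execProg hG) κt with queue := q }) = some (QInstr.qread (D.addrR + 1)) := by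
        rw [instr_eq]; show (D.execProg hG).code[(pend _ (cstep _ κt)).1]? = _; rw [hpt', D.code_R hG]
      have hlen := length_of_mem_support_tokRun toks hN0 hok q hq
      have hne : q ≠ [] := fun h => by subst h; simp at hlen; omega
      have hpk : (cstep (D.execProg hG) κt).parked = [] := by rw [hct]; exact t3.trans hpkf
      refine ⟨fun j hj => ?_, fun g j hj => ?_, fun j hj => ?_⟩ <;> rw [hi] at hj <;> cases hj
      exact ⟨hne, hpk⟩
  · -- idle
    rw [hs3, show s - 1 - t₀ - tokCost toks = 2 + (s - 1 - t₀ - tokCost toks - 2) by omega, stepRun_add_steps, r7]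
    obtain ⟨κi, i1, -, -, -, -, -, i7⟩ := stepRun_idle (D := D) (hG := hG) (s - 1 - t₀ - tokCost toks - 2)
      (tokRun toks (Finsupp.single (x ++ [false]) 1)) r1
    rw [i7]
    refine goodV_liftQP_of_none _ ?_ _
    rw [instr_eq, i1, D.code_halt hG]

/-- **Every configuration of the executor's run satisfies `StepOK`.** [folklore] -/
theorem stepOK_confRun {hG : G.IsUnitary} (x : List Bool) (toks : List (Tok G)) {tf : ℕ}
    (hPf : D.Pf.step^[tf] ⟨0, AStore.single D.inp (List.replicate x.length true)⟩ = ⟨D.Pf.length, AStore.single D.out (code toks)⟩)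
    (hok : TokListOK toks (x.length + 1)) (s : ℕ) (c : (D.execProg hG).Conf) (hc : c ∈ ((D.execProg hG).confRun x s).support) :
    (D.execProg hG).StepOK x.length (s + 1) c :=
  stepOK_of_qShape (D := D) (hG := hG) x hc (goodV_confRun (D := D) (hG := hG) x toks hPf hok s c hc)

/-! ### The acceptance probability of the executor -/

/-- **The acceptance probability of the executor machine** (positioned semantics), observed at
the boundary of sweep `s + 1` for `s ≥ tf + tokCost toks + 4`: the Born weight of `head = 1` in
the token run of `|x 0⟩`. [cite: NishimuraOzawa2002, Lemma 5.1] -/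
theorem pacceptProbAt_execProg {hG : G.IsUnitary} (x : List Bool) (toks : List (Tok G)) {tf : ℕ}
    (hPf : D.Pf.step^[tf] ⟨0, AStore.single D.inp (List.replicate x.length true)⟩ = ⟨D.Pf.length, AStore.single D.out (code toks)⟩)
    (hok : TokListOK toks (x.length + 1)) {s : ℕ} (hs : tf + tokCost toks + 4 ≤ s) :
    (D.execProg hG).machine.pacceptProbAt x (SweepSpec.sweepTime x.length (s + 1)) =
      (tokRun toks (Finsupp.single (x ++ [false]) 1)).sum fun q a => if q.head? = some true then ‖a‖ ^ 2 else 0 := by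
  rw [(D.execProg hG).pacceptProbAt_eq x (stepOK_confRun (D := D) (hG := hG) x toks hPf hok) s]
  exact acceptWeight_confRun (D := D) (hG := hG) x toks hPf hok hs

/-- **The same in the translation-quotient semantics** of the tree's `QTM.acceptProbAt` (the
machine is head-oblivious at sweep boundaries, `SweepSpec.acceptProbAt_sweepTime`). [cite: NishimuraOzawa2002, Lemma 5.1] -/
theorem acceptProbAt_execProg {hG : G.IsUnitary} (x : List Bool) (toks : List (Tok G)) {tf : ℕ}
    (hPf : D.Pf.step^[tf] ⟨0, AStore.single D.inp (List.replicate x.length true)⟩ = ⟨D.Pf.length, AStore.single D.out (code toks)⟩)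
    (hok : TokListOK toks (x.length + 1)) {s : ℕ} (hs : tf + tokCost toks + 4 ≤ s) :
    (D.execProg hG).machine.acceptProbAt x (SweepSpec.sweepTime x.length (s + 1)) =
      (tokRun toks (Finsupp.single (x ++ [false]) 1)).sum fun q a => if q.head? = some true then ‖a‖ ^ 2 else 0 := by
  rw [← pacceptProbAt_execProg (D := D) (hG := hG) x toks hPf hok hs]
  show (D.execProg hG).spec.machine.acceptProbAt x _ = (D.execProg hG).spec.machine.pacceptProbAt x _
  rw [SweepSpec.acceptProbAt_sweepTime, SweepSpec.pacceptProbAt_sweepTime]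

end Interp

end ExecData

end QSMExec

end Literature.Computability.QuantumComplexity
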